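import Literature.Geometry.Kaehler.ComplexTorusLineBundleFockSupBound
import Literature.Geometry.Kaehler.ComplexTorusLineBundleCoherentStates
import Literature.Geometry.Kaehler.ComplexTorusLineBundleDolbeault
import Mathlib.Analysis.Calculus.SmoothSeries
import Mathlib.Analysis.Calculus.ContDiff.FiniteDimension
import Mathlib.Analysis.InnerProductSpace.PiL2
import HarnessLib

/-!
# The Fock expansion of the smooth sections of a positive line bundle on a complex torus, and the
# Dolbeault vanishing `H^{0,q}_{∂̄}(X, L) = 0` (`q ≥ 1`) with Theorem 1.6.1 of Lange 2023 for positive `L`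

Layer `Literature/Geometry/Kaehler`, namespace `Literature.Geometry.Kaehler.ComplexTorus`; lane `lit-hodgefound`,
Layer A2, row A2-92 of `run/shared/lean/pub/lit-hodgefound/SKELETON.md` (seat `lit-hodgefound-skel-2`): STAGES 3b–4
of the seat's programme for **Lange's Theorem 1.6.1 "`H^q(L) ≃ ℋ^q(L)`" and Theorem 1.6.4 "`H^q(X, L) = 0` for
`q > g − r`" for a POSITIVE DEFINITE line bundle `L = L(H, χ)`** by the Fock expansion of `A^{0,0}(L)` (rows
A2-88 `ComplexTorusLineBundleFockStates` — Stage 1: Fock states `δ̄^α κ`, ladders, orthogonality, rapid decay of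
the coefficients; A2-89 `ComplexTorusLineBundleCoherentStates` — Stage 2: completeness; A2-90/A2-91
`ComplexTorusLineBundleSupBound` / `ComplexTorusLineBundleFockSupBound` — Stage 3a: Folland's Lemma (1.85) for `L`).
DEFINITIONS WITH BODIES (`fockWt`, `IsFockData`, `annData`, `fockSeries`, `coordConst`, `greenData`) and THEOREMS;
no named fact, no `sorry`.

Let `X = V/Λ`, `H` a Riemann form (positive definite) with semicharacter `χ`, `L = L(H, χ)`, `A^{0,0}(L(H, χ))` the
smooth theta functions (`smoothTheta`), `H⁰(L(H, χ))` the holomorphic ones (`thetaFunctions`), `( , )`, `‖·‖` the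
`L²_h` inner product and norm (Lange (1.25)), `e = (e_ν)_{ν<g}` an `H`-orthogonal `ℂ`-basis of `V`
(`bB : Module.Basis (Fin g) ℂ E`, `h_ν = H(e_ν, e_ν) > 0`), `k_ν > 0` Kähler weights, `∂̄_ν = dbarAlong (e ν)`,
`δ̄_ν = deltaBar η (e ν)`, `N(α) = Π_ν (π h_ν)^{α_ν} α_ν!` (`fockNormSq`).

## Part A — synthesis (§1–§7; Folland §1.7 (vii), Lemma (1.85), Thm. (1.86) run for `L`)

For RAPIDLY DECREASING `H⁰(L(H, χ))`-VALUED FOCK DATA `κ = (κ_α)_α` — `κ_α ∈ H⁰(L(H, χ))` and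
`Σ_α (|α| + 1)^k √N(α) ‖κ_α‖ < ∞` for all `k` (`IsFockData`) — the Fock series `S κ = Σ_α δ̄^α κ_α` (`fockSeries`)

* converges absolutely, with `|S κ (v)| e^{-πH(v,v)/2} ≤ K Σ_α w_{2 rk Λ}(α)` (§2);
* satisfies the functional equation of `L(H, χ)` (§2);
* is differentiable with `D(S κ) = Σ_α D(δ̄^α κ_α)` (termwise differentiation on balls, the derivatives being
  bounded in operator norm by `e^{π‖η‖R²/2} C (|α| + 2)^{2 rk Λ + 1} √N(α) ‖κ_α‖`, §3–§4);
* has `∂̄_w (S κ) = S(Σ_ν conj(e_ν^*(w)) A_ν κ)` and `δ̄_w (S κ) = S(Σ_ν e_ν^*(w) S_ν κ)` — again Fock series of Fock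
  data, the annihilation/creation shifts `A_ν`, `S_ν` preserving rapid decrease (§1, §5);
* is therefore `C^∞` (induction on the order with `D_y S = ∂̄_y S − δ̄_y S + π H(y, ·) S` and Mathlib's
  `contDiff_succ_iff_fderiv_apply`, §6), i.e. **`S κ ∈ A^{0,0}(L(H, χ))`** (`IsFockData.fockSeries_mem_smoothTheta`);
* has inner products `(S κ, g) = Σ_α (δ̄^α κ_α, g)` with every `g ∈ A^{0,0}(L(H, χ))` (dominated convergence on the
  compact torus) and hence the **Fock coefficients `(S κ, δ̄^β θ) = N(β) (κ_β, θ)`** for `θ ∈ H⁰(L(H, χ))` (§7).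

## Part B — analysis and the expansion theorem (§8–§11; Folland §1.7 (vii) for `L`)

* §8 `IsRiemannForm.eq_zero_of_forall_ahInner_fockOp_eq_zero`: a smooth section all of whose Fock coefficients
  `(f, δ̄^β θ)` (`θ ∈ H⁰(L(H, χ))`) vanish is zero (Stage 2 + `δ̄_y^N θ` is a standard Fock sum,
  `exists_iterate_deltaBar_eq_fockSum`);
* §9 tools: `fockOp_finset_sum_smul`, `summable_inv_deg_add_one_pow` (`Σ_{α ∈ ℕ^g} (|α|+1)^{-2g} < ∞`);
* §10 `exists_ahInner_orthonormalBasis`: an `L²_h`-orthonormal basis `θ_1, …, θ_n` of the finite-dimensional space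
  `H⁰(L(H, χ))` with `f = Σ_i (f, θ_i) θ_i` (Gram–Schmidt via `InnerProductSpace.Core`);
* §11 `summable_pow_mul_norm_ahInner_fockOp_div`: `Σ_α (|α|+1)^k |(φ, δ̄^α θ)|/‖δ̄^α θ‖ < ∞` for every `k`
  (Stage-1 `sum_fockCoeff_pow_le` — the eigenvalue trick `(Δ_∅ φ, δ̄^α θ) = λ(α)(φ, δ̄^α θ)` with Bessel — plus
  `2ab ≤ a² + b²`), and **`IsRiemannForm.exists_isFockData_fockSeries_eq`**: every `φ ∈ A^{0,0}(L(H, χ))` is the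
  Fock series of the rapidly decreasing data `κ_α(φ) = Σ_i ((φ, δ̄^α θ_i)/N(α)) θ_i`:  **`φ = Σ_α δ̄^α κ_α(φ)`**;
  with `IsFockData.ahInner_sub_self_eq_zero_of_fockSeries_eq` / `IsFockData.eq_of_fockSeries_eq` (uniqueness of the
  data) this identifies `A^{0,0}(L(H, χ))` with the rapidly decreasing `H⁰(L(H, χ))`-valued Fock data — Folland's
  §1.7 (vii) ("`f ∈ S(ℝⁿ)` iff its Hermite coefficients are rapidly decreasing") for the line bundle `L`.

## Part C — Dolbeault vanishing and Theorem 1.6.1 for positive `L` (§12–§15; Lange Thm. 1.6.4 with `r = g`, Thm. 1.6.1)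

Row A2-77 built `A^{0,q}(L)` as coefficient families `σ : Finset (Fin g) → (V → ℂ)` (`σ = Σ_I σ_I dv̄_I`) with
`∂̄ = dbarForm`, `δ̄ = deltaForm`, `Δ = ∂̄δ̄ + δ̄∂̄ = laplaceForm` and Prop. 1.6.3 `Δ(φ dv̄_I) = Δ_I(φ) dv̄_I`
(`laplaceForm_apply`, `laplaceI`); row A2-79 built `Z^{0,q}_{∂̄} = dbarClosedForms`, `B^{0,q}_{∂̄} = dbarExactForms`,
`H^{0,q}_{∂̄}(X, L) = dbarCohomology` and proved `ℋ^q(L) ↪ H^{0,q}_{∂̄}(X, L)` (bijective for `q = 0`), leaving the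
surjectivity for `q ≥ 1` (the Hodge theorem Lange quotes as Thm. 1.6.1) aside.  Here:

* §12 `IsFockData.smul_fun`, **`IsFockData.deltaBar_dbarAlong_basis_fockSeries`** (`δ̄_ν ∂̄_ν` multiplies the
  data by `π h_ν α_ν`), **`IsFockData.laplaceI_fockSeries`** (`Δ_I` multiplies the data by
  `λ_I(α) = Σ_ν k_ν^{-1} π h_ν α_ν + π Σ_{i∈I} k_i^{-1} h_i` = `fockEigenvalue`);
* §13 the Green data `G_I κ = κ/λ_I` (`greenData`; Fock data for `I ≠ ∅` since `λ_I ≥ π k_i^{-1} h_i > 0`,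
  `exists_pos_le_fockEigenvalue`), `λ_I · G_I κ = κ`, and the **key identity `λ_{J∖ν}(β + 1_ν) = λ_J(β)`**
  (`fockEigenvalue_erase_add_single`) giving `A_ν (G_{J∖ν} κ) = G_J (A_ν κ)` (`annData_greenData_erase`) —
  i.e. `∂̄ G = G ∂̄`;
* §14 **`IsRiemannForm.mem_dbarExactForms_of_mem_dbarClosedForms`**: for `q ≥ 1` every `σ ∈ Z^{0,q}_{∂̄}(X, L)` is
  `∂̄`-exact.  Proof: expand `σ_I = Σ_α δ̄^α κ^I_α`; put `τ_I = Σ_α δ̄^α (κ^I_α/λ_I(α))`; then `Δτ = σ` (§12–§13),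
  and `(∂̄τ)_J = Σ_β δ̄^β (D_J/λ_J)_β` where `D_J = Σ_{ν∈J} ε(ν, J∖ν) A_ν κ^{J∖ν}` is the Fock data of
  `(∂̄σ)_J = 0`, so `D_J = 0` (uniqueness of Fock data) and `∂̄τ = 0`; hence `σ = Δτ = ∂̄δ̄τ + δ̄∂̄τ = ∂̄(δ̄τ)`.
  **`IsRiemannForm.dbarClosedForms_le_dbarExactForms`**: `Z^{0,q}_{∂̄} ≤ B^{0,q}_{∂̄}`, i.e.
  `H^{0,q}_{∂̄}(X, L(H, χ)) = 0` for `q ≥ 1`;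
* §15 the same on the quotient of row A2-79 (`IsRiemannForm.subsingleton_dbarCohomology`,
  `finrank_dbarCohomology_eq_zero`, `rank_dbarCohomology_eq_zero`), **Theorem 1.6.1 for positive `L` in every
  degree** (`IsRiemannForm.harmonicToDolbeault_bijective`: `ℋ^q(L) → H^{0,q}_{∂̄}(X, L)` is bijective — degree `0`
  from A2-79, degrees `q ≥ 1` because the target vanishes and the map is injective), `ℋ^q(L) = 0` for `q ≥ 1`
  recovered from it (`harmonicForms_eq_bot`, Cor. 1.6.7 with `s = 0`), and the table
  **`dim_ℂ H^{0,q}_{∂̄}(X, L) = [q = 0] · h⁰(L)`** (`IsRiemannForm.finrank_dbarCohomology`).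

Part C is Theorem 1.6.4 for `r = g` ("`H^q(L) = 0` for `q > g − r`") in the `∂̄`-cohomology that A2-79 takes as
`H^q(X, L)` (Dolbeault, Huybrechts Def. 2.6.24), proved by the Fock-expansion route instead of Theorem 1.6.1 +
Corollary 1.6.7 (Lange quotes Thm. 1.6.1 from Griffiths–Harris); with A2-79's injection it yields Theorem 1.6.1 for
positive `L` in all degrees.  The sheaf-theoretic identification `H^{0,q}_{∂̄}(X, L) = H^q(X, L)` (Dolbeault's
theorem) is A2-79's standing convention, cited there, not formalised.

## References

* [Folland1989] G. B. Folland, *Harmonic Analysis in Phase Space*, Princeton UP 1989, §1.7 (1.81)–(1.82), (vii),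
  Lemma (1.85), Theorem (1.86) [p0047–p0048].
* [Lange2023AbelianVarietiesComplex] H. Lange, *Abelian Varieties over the Complex Numbers*, Springer 2023,
  §1.6.1 (1.23)–(1.25), Lemma 1.6.2, Prop. 1.6.3, Thm. 1.6.1 [p0063–p0065]; §1.6.2 Thm. 1.6.4, Lemma 1.6.6,
  Cor. 1.6.7 [p0066–p0067].
* [HuybrechtsCG2005] D. Huybrechts, *Complex Geometry*, Springer 2005, Def. 2.6.24, Cor. 4.1.14.

[cite: Lange2023AbelianVarietiesComplex, §1.6.2 Thm. 1.6.4] [cite: Folland1989, §1.7 Lemma (1.85)]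
-/

noncomputable section

open scoped Manifold ContDiff Topology Real ComplexConjugate
open Set Filter Function Complex MeasureTheory Finset
open Literature.Analysis.Complex
open Literature.Analysis.FunctionSpaces

namespace Literature.Geometry.Kaehler

namespace ComplexTorus

/-! # Part A — Synthesis of smooth sections from rapidly decreasing Fock data -/

/-! ## §1 Rapidly decreasing `H⁰(L)`-valued Fock data and its elementary transformations -/

section Data

variable {ι : Type*} [Fintype ι] {E : Type*} [NormedAddCommGroup E] [NormedSpace ℂ E] [FiniteDimensional ℂ E]
  (Φ : (ι → ℝ) ≃L[ℝ] E) (η : E [⋀^Fin 2]→L[ℝ] ℝ) (χ : (ι → ℤ) → ℂ) {g : ℕ} (b : Fin g → E)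

/-- The size of the `α`-th term of Fock data, `w_k(α) = (|α| + 1)^k √N(α) ‖κ_α‖`. [cite: Folland1989, §1.7 Lemma (1.85)] -/
def fockWt (k : ℕ) (κ : (Fin g → ℕ) → E → ℂ) (α : Fin g → ℕ) : ℝ :=
  ((∑ i, α i : ℕ) + 1 : ℝ) ^ k * (Real.sqrt (fockNormSq η b α) * ahNorm Φ η (κ α))

/-- **Rapidly decreasing `H⁰(L(H, χ))`-valued Fock data**: `κ_α ∈ H⁰(L(H, χ))` for all `α` and
`Σ_α (|α| + 1)^k √N(α) ‖κ_α‖ < ∞` for every `k` — the coefficient side of the Fock expansion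
(`N(α) = ‖δ̄^α θ‖²/‖θ‖²`, so `√N(α) ‖κ_α‖ = ‖δ̄^α κ_α‖`). [cite: Folland1989, §1.7 Lemma (1.85)] -/
structure IsFockData (κ : (Fin g → ℕ) → E → ℂ) : Prop where
  mem : ∀ α, κ α ∈ thetaFunctions Φ (canonicalFactor Φ η χ)
  rapid : ∀ k : ℕ, Summable (fockWt Φ η b k κ)

variable {Φ η χ b}

omit [FiniteDimensional ℂ E] in
/-- Unfolding of `fockWt`. [cite: Folland1989, §1.7 Lemma (1.85)] -/
theorem fockWt_apply (k : ℕ) (κ : (Fin g → ℕ) → E → ℂ) (α : Fin g → ℕ) :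
    fockWt Φ η b k κ α = ((∑ i, α i : ℕ) + 1 : ℝ) ^ k * (Real.sqrt (fockNormSq η b α) * ahNorm Φ η (κ α)) :=
  rfl

omit [FiniteDimensional ℂ E] in
/-- `fockWt` is non-negative. [cite: Folland1989, §1.7 Lemma (1.85)] -/
theorem fockWt_nonneg (k : ℕ) (κ : (Fin g → ℕ) → E → ℂ) (α : Fin g → ℕ) : 0 ≤ fockWt Φ η b k κ α := by
  rw [fockWt_apply]
  exact mul_nonneg (by positivity) (mul_nonneg (Real.sqrt_nonneg _) (ahNorm_nonneg Φ η _))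

omit [FiniteDimensional ℂ E] in
/-- `fockWt` is monotone in `k`. [cite: Folland1989, §1.7 Lemma (1.85)] -/
theorem fockWt_mono {k k' : ℕ} (hkk' : k ≤ k') (κ : (Fin g → ℕ) → E → ℂ) (α : Fin g → ℕ) :
    fockWt Φ η b k κ α ≤ fockWt Φ η b k' κ α := by
  rw [fockWt_apply, fockWt_apply]
  refine mul_le_mul_of_nonneg_right (pow_le_pow_right₀ ?_ hkk') (mul_nonneg (Real.sqrt_nonneg _) (ahNorm_nonneg Φ η _))
  have : (0 : ℝ) ≤ (∑ i, α i : ℕ) := Nat.cast_nonneg _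
  linarith

omit [FiniteDimensional ℂ E] in
/-- `fockWt` of the zero data vanishes. [cite: Folland1989, §1.7 Lemma (1.85)] -/
@[simp] theorem fockWt_zero (k : ℕ) (α : Fin g → ℕ) : fockWt Φ η b k (0 : (Fin g → ℕ) → E → ℂ) α = 0 := by
  simp [fockWt_apply]

omit [FiniteDimensional ℂ E] in
/-- `fockWt` of `c • κ`. [cite: Folland1989, §1.7 Lemma (1.85)] -/
theorem fockWt_smul (k : ℕ) (c : ℂ) (κ : (Fin g → ℕ) → E → ℂ) (α : Fin g → ℕ) :
    fockWt Φ η b k (c • κ) α = ‖c‖ * fockWt Φ η b k κ α := by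
  rw [fockWt_apply, fockWt_apply, Pi.smul_apply, ahNorm_smul]
  ring

/-- `fockWt` of a sum of `H⁰(L)`-valued data. [cite: Folland1989, §1.7 Lemma (1.85)] -/
theorem fockWt_add_le (hη : IsNSForm Φ η) (hχ : IsSemicharacter Φ η χ) (k : ℕ) {κ κ' : (Fin g → ℕ) → E → ℂ}
    (hκ : ∀ α, κ α ∈ thetaFunctions Φ (canonicalFactor Φ η χ))
    (hκ' : ∀ α, κ' α ∈ thetaFunctions Φ (canonicalFactor Φ η χ)) (α : Fin g → ℕ) :
    fockWt Φ η b k (κ + κ') α ≤ fockWt Φ η b k κ α + fockWt Φ η b k κ' α := by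
  rw [fockWt_apply, fockWt_apply, fockWt_apply, Pi.add_apply, ← mul_add, ← mul_add]
  refine mul_le_mul_of_nonneg_left (mul_le_mul_of_nonneg_left ?_ (Real.sqrt_nonneg _)) (by positivity)
  exact ahNorm_add_le hη hχ (thetaFunctions_le_smoothTheta _ (hκ α)) (thetaFunctions_le_smoothTheta _ (hκ' α))

omit [FiniteDimensional ℂ E] in
/-- The zero data is Fock data. [cite: Folland1989, §1.7 Lemma (1.85)] -/
theorem IsFockData.zero : IsFockData Φ η χ b (0 : (Fin g → ℕ) → E → ℂ) :=
  ⟨fun _ ↦ zero_mem _, fun k ↦ by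
    have : fockWt Φ η b k (0 : (Fin g → ℕ) → E → ℂ) = fun _ ↦ 0 := funext (fockWt_zero k)
    rw [this]
    exact summable_zero⟩

/-- Fock data is stable under addition. [cite: Folland1989, §1.7 Lemma (1.85)] -/
theorem IsFockData.add (hη : IsNSForm Φ η) (hχ : IsSemicharacter Φ η χ) {κ κ' : (Fin g → ℕ) → E → ℂ}
    (hκ : IsFockData Φ η χ b κ) (hκ' : IsFockData Φ η χ b κ') : IsFockData Φ η χ b (κ + κ') :=
  ⟨fun α ↦ add_mem (hκ.mem α) (hκ'.mem α), fun k ↦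
    (Summable.add (hκ.rapid k) (hκ'.rapid k)).of_nonneg_of_le (fun α ↦ fockWt_nonneg k _ α)
      fun α ↦ fockWt_add_le hη hχ k hκ.mem hκ'.mem α⟩

omit [FiniteDimensional ℂ E] in
/-- Fock data is stable under scalars. [cite: Folland1989, §1.7 Lemma (1.85)] -/
theorem IsFockData.smul {κ : (Fin g → ℕ) → E → ℂ} (hκ : IsFockData Φ η χ b κ) (c : ℂ) :
    IsFockData Φ η χ b (c • κ) :=
  ⟨fun α ↦ Submodule.smul_mem _ _ (hκ.mem α), fun k ↦ by
    have : fockWt Φ η b k (c • κ) = fun α ↦ ‖c‖ * fockWt Φ η b k κ α := funext (fockWt_smul k c κ)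
    rw [this]
    exact (hκ.rapid k).mul_left ‖c‖⟩

/-- Fock data is stable under finite linear combinations. [cite: Folland1989, §1.7 Lemma (1.85)] -/
theorem IsFockData.finset_sum_smul (hη : IsNSForm Φ η) (hχ : IsSemicharacter Φ η χ) {σ : Type*} (s : Finset σ)
    (c : σ → ℂ) {κ : σ → (Fin g → ℕ) → E → ℂ} (hκ : ∀ i, IsFockData Φ η χ b (κ i)) :
    IsFockData Φ η χ b (∑ i ∈ s, c i • κ i) := by
  classical
  induction s using Finset.induction_on with
  | empty => simpa using IsFockData.zero
  | insert a s ha ih => rw [Finset.sum_insert ha]; exact ((hκ a).smul (c a)).add hη hχ ih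

/-- The data of Fock data is `C^∞`. [cite: Folland1989, §1.7 Lemma (1.85)] -/
theorem IsFockData.contDiff {κ : (Fin g → ℕ) → E → ℂ} (hκ : IsFockData Φ η χ b κ) (α : Fin g → ℕ) :
    ContDiff ℝ ∞ (κ α) :=
  (thetaFunctions_le_smoothTheta _ (hκ.mem α)).1

/-! ### Multi-index bookkeeping (as in the Fock-state files) -/

omit [Fintype ι] [FiniteDimensional ℂ E] in
/-- `(α + 1_ν)_ν = α_ν + 1`. [folklore] -/
private theorem add_single_apply_same' (α : Fin g → ℕ) (ν : Fin g) : (α + Pi.single ν 1 : Fin g → ℕ) ν = α ν + 1 := by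
  simp

omit [Fintype ι] [FiniteDimensional ℂ E] in
/-- `α + 1_ν - 1_ν = α`. [folklore] -/
private theorem add_single_sub_single' (ν : Fin g) (α : Fin g → ℕ) : α + Pi.single ν 1 - Pi.single ν 1 = α := by
  funext j; simp only [Pi.add_apply, Pi.sub_apply]; omega

omit [Fintype ι] [FiniteDimensional ℂ E] in
/-- `α - 1_ν + 1_ν = α` when `α_ν ≠ 0`. [folklore] -/
private theorem sub_single_add_single' {ν : Fin g} {α : Fin g → ℕ} (hα : α ν ≠ 0) :
    α - Pi.single ν 1 + Pi.single ν 1 = α := by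
  funext j
  simp only [Pi.add_apply, Pi.sub_apply]
  by_cases hj : j = ν
  · subst hj; rw [Pi.single_eq_same]; omega
  · rw [Pi.single_eq_of_ne hj]; omega

omit [Fintype ι] [FiniteDimensional ℂ E] in
/-- `|α + 1_ν| = |α| + 1`. [folklore] -/
private theorem sum_add_single' (α : Fin g → ℕ) (ν : Fin g) : ∑ i, (α + Pi.single ν 1 : Fin g → ℕ) i = ∑ i, α i + 1 := by
  simp only [Pi.add_apply, Finset.sum_add_distrib, Finset.sum_pi_single', Finset.mem_univ, if_true]

omit [Fintype ι] [FiniteDimensional ℂ E] in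
/-- `α ↦ α + 1_ν` is injective. [folklore] -/
private theorem add_single_injective (ν : Fin g) : Function.Injective fun α : Fin g → ℕ ↦ α + Pi.single ν 1 :=
  fun _ _ h ↦ add_right_cancel h

omit [Fintype ι] [FiniteDimensional ℂ E] in
/-- Summability transported along the injective shift `α ↦ α + 1_ν`: a non-negative family vanishing where
`β_ν = 0` and dominated on the shifted indices by a summable family is summable. [folklore] -/
private theorem summable_of_shift_le {ν : Fin g} {f G : (Fin g → ℕ) → ℝ} (hG : Summable G) (hf0 : ∀ β, 0 ≤ f β)
    (hzero : ∀ β : Fin g → ℕ, β ν = 0 → f β = 0) (hle : ∀ α, f (α + Pi.single ν 1) ≤ G α) : Summable f := by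
  have h1 : Summable (f ∘ fun α : Fin g → ℕ ↦ α + Pi.single ν 1) :=
    hG.of_nonneg_of_le (fun α ↦ hf0 _) hle
  refine ((add_single_injective ν).summable_iff fun β hβ ↦ hzero β ?_).1 h1
  by_contra hne
  exact hβ ⟨β - Pi.single ν 1, sub_single_add_single' hne⟩

omit [Fintype ι] [FiniteDimensional ℂ E] in
/-- `√N(α + 1_ν) = √(π h_ν) √(α_ν + 1) √N(α)`. [cite: Folland1989, §1.7 (1.82)] -/
private theorem sqrt_fockNormSq_add_single (hpos : ∀ ν, 0 < frameDiag η b ν) (α : Fin g → ℕ) (ν : Fin g) :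
    Real.sqrt (fockNormSq η b (α + Pi.single ν 1)) =
      Real.sqrt (π * frameDiag η b ν) * Real.sqrt ((α ν : ℝ) + 1) * Real.sqrt (fockNormSq η b α) := by
  rw [fockNormSq_add_single, Real.sqrt_mul' _ (fockNormSq_pos η b hpos α).le,
    Real.sqrt_mul (mul_pos Real.pi_pos (hpos ν)).le]

omit [Fintype ι] [FiniteDimensional ℂ E] in
/-- `√(α_ν + 1) ≤ |α| + 1`. [folklore] -/
private theorem sqrt_apply_add_one_le (α : Fin g → ℕ) (ν : Fin g) :
    Real.sqrt ((α ν : ℝ) + 1) ≤ ((∑ i, α i : ℕ) : ℝ) + 1 := by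
  rw [Real.sqrt_le_left (by positivity)]
  have h1 : (α ν : ℝ) ≤ (∑ i, α i : ℕ) := by
    exact_mod_cast Finset.single_le_sum (f := α) (fun j _ ↦ Nat.zero_le _) (Finset.mem_univ ν)
  nlinarith

omit [FiniteDimensional ℂ E] in
/-- **The creation shift preserves Fock data** (`√N(α + 1_ν) = √(π h_ν (α_ν + 1)) √N(α)` costs one power of
`|α| + 1`). [cite: Folland1989, §1.7 (1.82)] -/
theorem IsFockData.creShift (hpos : ∀ ν, 0 < frameDiag η b ν) {κ : (Fin g → ℕ) → E → ℂ}
    (hκ : IsFockData Φ η χ b κ) (ν : Fin g) : IsFockData Φ η χ b (creShift ν κ) := by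
  refine ⟨creShift_mem hκ.mem ν, fun k ↦ ?_⟩
  set C : ℝ := Real.sqrt (π * frameDiag η b ν) * 2 ^ k with hC
  refine summable_of_shift_le ((hκ.rapid (k + 1)).mul_left C) (fun β ↦ fockWt_nonneg k _ β)
    (fun β hβ ↦ by rw [fockWt_apply, ComplexTorus.creShift, if_pos hβ, ahNorm_zero]; ring) fun α ↦ ?_
  rw [fockWt_apply, fockWt_apply, creShift_add_single, sqrt_fockNormSq_add_single hpos, sum_add_single']
  set A : ℝ := ((∑ i, α i : ℕ) : ℝ) + 1 with hA
  have hA1 : 1 ≤ A := by rw [hA]; have : (0:ℝ) ≤ (∑ i, α i : ℕ) := Nat.cast_nonneg _; linarith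
  have hs : 0 ≤ Real.sqrt (fockNormSq η b α) * ahNorm Φ η (κ α) := mul_nonneg (Real.sqrt_nonneg _) (ahNorm_nonneg Φ η _)
  have hsq : Real.sqrt ((α ν : ℝ) + 1) ≤ A := sqrt_apply_add_one_le α ν
  have hpow : (((∑ i, α i + 1 : ℕ) : ℝ) + 1) ^ k ≤ 2 ^ k * A ^ k := by
    rw [← mul_pow]
    refine pow_le_pow_left₀ (by positivity) ?_ _
    rw [hA, Nat.cast_add, Nat.cast_one]
    linarith
  have hh : 0 ≤ Real.sqrt (π * frameDiag η b ν) := Real.sqrt_nonneg _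
  calc (((∑ i, α i + 1 : ℕ) : ℝ) + 1) ^ k *
        (Real.sqrt (π * frameDiag η b ν) * Real.sqrt ((α ν : ℝ) + 1) * Real.sqrt (fockNormSq η b α) * ahNorm Φ η (κ α))
      = Real.sqrt (π * frameDiag η b ν) * ((((∑ i, α i + 1 : ℕ) : ℝ) + 1) ^ k * Real.sqrt ((α ν : ℝ) + 1)) *
          (Real.sqrt (fockNormSq η b α) * ahNorm Φ η (κ α)) := by ring
    _ ≤ Real.sqrt (π * frameDiag η b ν) * ((2 ^ k * A ^ k) * A) * (Real.sqrt (fockNormSq η b α) * ahNorm Φ η (κ α)) :=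
        mul_le_mul_of_nonneg_right (mul_le_mul_of_nonneg_left
          (mul_le_mul hpow hsq (Real.sqrt_nonneg _) (by positivity)) hh) hs
    _ = C * (A ^ (k + 1) * (Real.sqrt (fockNormSq η b α) * ahNorm Φ η (κ α))) := by rw [hC]; ring

variable (η b) in
/-- **The annihilation shift of Fock data**: `(A_ν κ)_β = π h_ν (β_ν + 1) κ_{β + 1_ν}`, so that
`∂̄_{e_ν} Σ_α δ̄^α κ_α = Σ_β δ̄^β (A_ν κ)_β`. [cite: Folland1989, §1.7 (1.82)] -/
def annData (ν : Fin g) (κ : (Fin g → ℕ) → E → ℂ) : (Fin g → ℕ) → E → ℂ :=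
  fun β ↦ ((π * frameDiag η b ν * ((β ν : ℝ) + 1) : ℝ) : ℂ) • κ (β + Pi.single ν 1)

omit [Fintype ι] [FiniteDimensional ℂ E] in
/-- Unfolding of `annData`. [cite: Folland1989, §1.7 (1.82)] -/
theorem annData_apply (ν : Fin g) (κ : (Fin g → ℕ) → E → ℂ) (β : Fin g → ℕ) :
    annData η b ν κ β = ((π * frameDiag η b ν * ((β ν : ℝ) + 1) : ℝ) : ℂ) • κ (β + Pi.single ν 1) :=
  rfl

omit [FiniteDimensional ℂ E] in
/-- **The annihilation shift preserves Fock data** (`π h_ν (β_ν+1) √N(β) = √(π h_ν (β_ν+1)) √N(β + 1_ν)`).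
[cite: Folland1989, §1.7 (1.82)] -/
theorem IsFockData.annData (hpos : ∀ ν, 0 < frameDiag η b ν) {κ : (Fin g → ℕ) → E → ℂ}
    (hκ : IsFockData Φ η χ b κ) (ν : Fin g) : IsFockData Φ η χ b (annData η b ν κ) := by
  refine ⟨fun β ↦ Submodule.smul_mem _ _ (hκ.mem _), fun k ↦ ?_⟩
  set C : ℝ := Real.sqrt (π * frameDiag η b ν) with hC
  have hG : Summable fun β : Fin g → ℕ ↦ C * fockWt Φ η b (k + 1) κ (β + Pi.single ν 1) :=
    (((hκ.rapid (k + 1)).comp_injective (add_single_injective ν)).mul_left C)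
  refine hG.of_nonneg_of_le (fun β ↦ fockWt_nonneg k _ β) fun β ↦ ?_
  rw [fockWt_apply, fockWt_apply, annData_apply, ahNorm_smul, sqrt_fockNormSq_add_single hpos, sum_add_single',
    Complex.norm_real, Real.norm_eq_abs, abs_of_nonneg (by have := hpos ν; positivity)]
  set A : ℝ := ((∑ i, β i : ℕ) : ℝ) + 1 with hA
  have hA1 : 1 ≤ A := by rw [hA]; have : (0:ℝ) ≤ (∑ i, β i : ℕ) := Nat.cast_nonneg _; linarith
  have hh0 : 0 < π * frameDiag η b ν := mul_pos Real.pi_pos (hpos ν)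
  -- `π h (β_ν + 1) = C² (√(β_ν+1))²`
  have hsplit : π * frameDiag η b ν * ((β ν : ℝ) + 1) =
      (C * Real.sqrt ((β ν : ℝ) + 1)) * (C * Real.sqrt ((β ν : ℝ) + 1)) := by
    rw [hC, mul_mul_mul_comm, Real.mul_self_sqrt hh0.le, Real.mul_self_sqrt (by positivity)]
  have hsq : Real.sqrt ((β ν : ℝ) + 1) ≤ A := sqrt_apply_add_one_le β ν
  have hA' : A ≤ ((∑ i, β i + 1 : ℕ) : ℝ) + 1 := by rw [hA, Nat.cast_add, Nat.cast_one]; linarith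
  have hpow : A ^ k ≤ (((∑ i, β i + 1 : ℕ) : ℝ) + 1) ^ k := pow_le_pow_left₀ (by positivity) hA' _
  have hN : 0 ≤ Real.sqrt (fockNormSq η b β) := Real.sqrt_nonneg _
  have hK : 0 ≤ ahNorm Φ η (κ (β + Pi.single ν 1)) := ahNorm_nonneg Φ η _
  have hC0 : 0 ≤ C := Real.sqrt_nonneg _
  have hr : 0 ≤ Real.sqrt ((β ν : ℝ) + 1) := Real.sqrt_nonneg _
  rw [hsplit]
  calc A ^ k * (Real.sqrt (fockNormSq η b β) * (C * Real.sqrt ((β ν : ℝ) + 1) * (C * Real.sqrt ((β ν : ℝ) + 1)) *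
          ahNorm Φ η (κ (β + Pi.single ν 1))))
      = C * ((A ^ k * Real.sqrt ((β ν : ℝ) + 1)) *
          (C * Real.sqrt ((β ν : ℝ) + 1) * Real.sqrt (fockNormSq η b β) * ahNorm Φ η (κ (β + Pi.single ν 1)))) := by
        ring
    _ ≤ C * (((((∑ i, β i + 1 : ℕ) : ℝ) + 1) ^ k * ((((∑ i, β i + 1 : ℕ) : ℝ) + 1))) *
          (C * Real.sqrt ((β ν : ℝ) + 1) * Real.sqrt (fockNormSq η b β) * ahNorm Φ η (κ (β + Pi.single ν 1)))) :=
        mul_le_mul_of_nonneg_left (mul_le_mul_of_nonneg_right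
          (mul_le_mul hpow (hsq.trans hA') hr (by positivity)) (by positivity)) hC0
    _ = C * ((((∑ i, β i + 1 : ℕ) : ℝ) + 1) ^ (k + 1) *
          (C * Real.sqrt ((β ν : ℝ) + 1) * Real.sqrt (fockNormSq η b β) * ahNorm Φ η (κ (β + Pi.single ν 1)))) := by
        ring

end Data

/-! ## §2 The Fock series `Σ_α δ̄^α κ_α`: weighted termwise bounds and absolute convergence -/

section Series

variable {ι : Type*} [Fintype ι] {E : Type*} [NormedAddCommGroup E] [NormedSpace ℂ E] [FiniteDimensional ℂ E]
  {Φ : (ι → ℝ) ≃L[ℝ] E} {η : E [⋀^Fin 2]→L[ℝ] ℝ} {χ : (ι → ℤ) → ℂ} {g : ℕ} {b : Fin g → E}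

variable (η b) in
/-- **The Fock series `Σ_α δ̄^α κ_α` of Fock data `κ`** (pointwise sum; absolutely convergent for rapidly
decreasing data). [cite: Folland1989, §1.7 Lemma (1.85)] -/
def fockSeries (κ : (Fin g → ℕ) → E → ℂ) : E → ℂ := fun v ↦ ∑' α, fockOp η b α (κ α) v

omit [Fintype ι] [FiniteDimensional ℂ E] in
/-- Unfolding of `fockSeries`. [cite: Folland1989, §1.7 Lemma (1.85)] -/
theorem fockSeries_apply (κ : (Fin g → ℕ) → E → ℂ) (v : E) : fockSeries η b κ v = ∑' α, fockOp η b α (κ α) v := rfl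

/-- `(M + D + 1)^{n} ≤ (D + 1)^n (M + 1)^n`. [folklore] -/
private theorem pow_shift_le (M D : ℝ) (hM : 0 ≤ M) (hD : 0 ≤ D) (n : ℕ) :
    (M + D + 1) ^ n ≤ (D + 1) ^ n * (M + 1) ^ n := by
  rw [← mul_pow]; exact pow_le_pow_left₀ (by positivity) (by nlinarith) _

/-- **The weighted sup bound of a standard Fock sum, square-rooted**: there is `K > 0` (from row A2-91) with
`|u(v)| e^{-πH(v,v)/2} ≤ K (M + 1)^{2·rk Λ} ‖u‖` for every standard Fock sum `u` of degree `≤ M` with `H⁰(L(H,χ))`-valued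
data, uniformly in `χ`. [cite: Folland1989, §1.7 Lemma (1.85)] -/
theorem IsNSForm.exists_norm_fockSum_mul_sqrt_ahWeight_le (hη : IsNSForm Φ η)
    (hb : ∀ μ ν, μ ≠ ν → hermOf η (b μ) (b ν) = 0) (hpos : ∀ ν, 0 < frameDiag η b ν)
    (hspan : ∀ w, w ∈ Submodule.span ℂ (Set.range b)) :
    ∃ K : ℝ, 0 < K ∧ ∀ {χ : (ι → ℤ) → ℂ}, IsSemicharacter Φ η χ → ∀ (M : ℕ) (κ : (Fin g → ℕ) → E → ℂ),
      (∀ α, κ α ∈ thetaFunctions Φ (canonicalFactor Φ η χ)) → ∀ v : E,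
        ‖fockSum η b M κ v‖ * Real.sqrt (ahWeight η v) ≤
          K * ((M : ℝ) + 1) ^ (2 * Fintype.card ι) * ahNorm Φ η (fockSum η b M κ) := by
  obtain ⟨K₀, hK₀, hK₀b⟩ := hη.exists_norm_sq_fockSum_mul_ahWeight_le hb hpos hspan
  set D : ℝ := 2 * Fintype.card ι with hD
  have hD0 : 0 ≤ D := by rw [hD]; positivity
  refine ⟨Real.sqrt K₀ * (D + 1) ^ (2 * Fintype.card ι), by positivity, fun hχ M κ hκ v ↦ ?_⟩
  have h := hK₀b hχ M κ hκ v
  have hu0 : 0 ≤ ahNorm Φ η (fockSum η b M κ) := ahNorm_nonneg Φ η _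
  have hw0 : 0 ≤ Real.sqrt (ahWeight η v) := Real.sqrt_nonneg _
  -- square roots
  have hsq : (‖fockSum η b M κ v‖ * Real.sqrt (ahWeight η v)) ^ 2 ≤
      (Real.sqrt K₀ * ((M : ℝ) + D + 1) ^ (2 * Fintype.card ι) * ahNorm Φ η (fockSum η b M κ)) ^ 2 := by
    rw [mul_pow, Real.sq_sqrt (ahWeight_pos η v).le, mul_pow, mul_pow, Real.sq_sqrt hK₀.le, ← pow_mul]
    calc ‖fockSum η b M κ v‖ ^ 2 * ahWeight η v
        ≤ K₀ * ((M : ℝ) + 2 * Fintype.card ι + 1) ^ (4 * Fintype.card ι) * ahNorm Φ η (fockSum η b M κ) ^ 2 := h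
      _ = K₀ * ((M : ℝ) + D + 1) ^ (2 * Fintype.card ι * 2) * ahNorm Φ η (fockSum η b M κ) ^ 2 := by
          rw [hD, show 2 * Fintype.card ι * 2 = 4 * Fintype.card ι by ring]
  have h1 := (pow_le_pow_iff_left₀ (mul_nonneg (norm_nonneg _) hw0) (by positivity) two_ne_zero).1 hsq
  refine h1.trans ?_
  have hM : (0 : ℝ) ≤ M := Nat.cast_nonneg M
  calc Real.sqrt K₀ * ((M : ℝ) + D + 1) ^ (2 * Fintype.card ι) * ahNorm Φ η (fockSum η b M κ)
      ≤ Real.sqrt K₀ * ((D + 1) ^ (2 * Fintype.card ι) * ((M : ℝ) + 1) ^ (2 * Fintype.card ι)) *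
          ahNorm Φ η (fockSum η b M κ) :=
        mul_le_mul_of_nonneg_right (mul_le_mul_of_nonneg_left (pow_shift_le M D hM hD0 _) (Real.sqrt_nonneg _)) hu0
    _ = _ := by ring

/-- **The weighted sup bound of a single Fock state, square-rooted**: with the same `K`,
`|δ̄^α θ (v)| e^{-πH(v,v)/2} ≤ K (|α| + 1)^{2·rk Λ} √N(α) ‖θ‖` for `θ ∈ H⁰(L(H,χ))`. [cite: Folland1989, §1.7 Lemma (1.85)] -/
theorem IsNSForm.exists_norm_fockOp_mul_sqrt_ahWeight_le (hη : IsNSForm Φ η)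
    (hb : ∀ μ ν, μ ≠ ν → hermOf η (b μ) (b ν) = 0) (hpos : ∀ ν, 0 < frameDiag η b ν)
    (hspan : ∀ w, w ∈ Submodule.span ℂ (Set.range b)) :
    ∃ K : ℝ, 0 < K ∧ ∀ {χ : (ι → ℤ) → ℂ}, IsSemicharacter Φ η χ → ∀ {θ : E → ℂ},
      θ ∈ thetaFunctions Φ (canonicalFactor Φ η χ) → ∀ (α : Fin g → ℕ) (v : E),
        ‖fockOp η b α θ v‖ * Real.sqrt (ahWeight η v) ≤
          K * (((∑ i, α i : ℕ) : ℝ) + 1) ^ (2 * Fintype.card ι) * (Real.sqrt (fockNormSq η b α) * ahNorm Φ η θ) := by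
  obtain ⟨K, hK, hKb⟩ := hη.exists_norm_fockSum_mul_sqrt_ahWeight_le hb hpos hspan
  refine ⟨K, hK, fun {χ} hχ {θ} hθ α v ↦ ?_⟩
  have h := hKb hχ (∑ i, α i) (fun β ↦ if β = α then θ else 0) (single_data_mem hθ α) v
  have hn : ahNorm Φ η (fockSum η b (∑ i, α i) fun β ↦ if β = α then θ else 0) =
      Real.sqrt (fockNormSq η b α) * ahNorm Φ η θ := by
    rw [← Real.sqrt_sq (ahNorm_nonneg Φ η (fockSum η b _ _)), ahNorm_sq_fockSum_single hη hχ hb hθ α,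
      Real.sqrt_mul (fockNormSq_pos η b hpos α).le, Real.sqrt_sq (ahNorm_nonneg Φ η θ)]
  rw [hn, fockSum_single hη.type_one_one] at h
  exact h

/-- **Absolute convergence of the Fock series of Fock data**, with the weighted bound
`Σ_α |δ̄^α κ_α (v)| e^{-πH(v,v)/2} ≤ K Σ_α w_{2 rk Λ}(α)`. [cite: Folland1989, §1.7 Lemma (1.85)] -/
theorem IsNSForm.exists_tsum_norm_fockOp_mul_sqrt_ahWeight_le (hη : IsNSForm Φ η)
    (hb : ∀ μ ν, μ ≠ ν → hermOf η (b μ) (b ν) = 0) (hpos : ∀ ν, 0 < frameDiag η b ν)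
    (hspan : ∀ w, w ∈ Submodule.span ℂ (Set.range b)) :
    ∃ K : ℝ, 0 < K ∧ ∀ {χ : (ι → ℤ) → ℂ}, IsSemicharacter Φ η χ → ∀ {κ : (Fin g → ℕ) → E → ℂ},
      IsFockData Φ η χ b κ → ∀ v : E,
        Summable (fun α ↦ ‖fockOp η b α (κ α) v‖) ∧
          (∑' α, ‖fockOp η b α (κ α) v‖) * Real.sqrt (ahWeight η v) ≤ K * ∑' α, fockWt Φ η b (2 * Fintype.card ι) κ α := by
  obtain ⟨K, hK, hKb⟩ := hη.exists_norm_fockOp_mul_sqrt_ahWeight_le hb hpos hspan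
  refine ⟨K, hK, fun {χ} hχ {κ} hκ v ↦ ?_⟩
  have hw : 0 < Real.sqrt (ahWeight η v) := Real.sqrt_pos.2 (ahWeight_pos η v)
  have hle : ∀ α, ‖fockOp η b α (κ α) v‖ ≤
      (Real.sqrt (ahWeight η v))⁻¹ * (K * fockWt Φ η b (2 * Fintype.card ι) κ α) := by
    intro α
    rw [le_inv_mul_iff₀ hw, mul_comm, fockWt_apply, ← mul_assoc]
    exact hKb hχ (hκ.mem α) α v
  have hsum : Summable fun α ↦ ‖fockOp η b α (κ α) v‖ :=
    (((hκ.rapid _).mul_left K).mul_left _).of_nonneg_of_le (fun α ↦ norm_nonneg _) hle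
  refine ⟨hsum, ?_⟩
  calc (∑' α, ‖fockOp η b α (κ α) v‖) * Real.sqrt (ahWeight η v)
      = ∑' α, ‖fockOp η b α (κ α) v‖ * Real.sqrt (ahWeight η v) := tsum_mul_right.symm
    _ ≤ ∑' α, K * fockWt Φ η b (2 * Fintype.card ι) κ α :=
        Summable.tsum_le_tsum (fun α ↦ by rw [fockWt_apply, ← mul_assoc]; exact hKb hχ (hκ.mem α) α v)
          (hsum.mul_right _) ((hκ.rapid _).mul_left K)
    _ = K * ∑' α, fockWt Φ η b (2 * Fintype.card ι) κ α := tsum_mul_left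

/-- The Fock series of Fock data converges absolutely at every point. [cite: Folland1989, §1.7 Lemma (1.85)] -/
theorem IsFockData.summable_apply (hη : IsNSForm Φ η) (hχ : IsSemicharacter Φ η χ)
    (hb : ∀ μ ν, μ ≠ ν → hermOf η (b μ) (b ν) = 0) (hpos : ∀ ν, 0 < frameDiag η b ν)
    (hspan : ∀ w, w ∈ Submodule.span ℂ (Set.range b)) {κ : (Fin g → ℕ) → E → ℂ} (hκ : IsFockData Φ η χ b κ)
    (v : E) : Summable fun α ↦ fockOp η b α (κ α) v := by
  obtain ⟨K, _, hKb⟩ := hη.exists_tsum_norm_fockOp_mul_sqrt_ahWeight_le hb hpos hspan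
  exact (hKb hχ hκ v).1.of_norm

/-- The Fock series is the sum of its terms. [cite: Folland1989, §1.7 Lemma (1.85)] -/
theorem IsFockData.hasSum_apply (hη : IsNSForm Φ η) (hχ : IsSemicharacter Φ η χ)
    (hb : ∀ μ ν, μ ≠ ν → hermOf η (b μ) (b ν) = 0) (hpos : ∀ ν, 0 < frameDiag η b ν)
    (hspan : ∀ w, w ∈ Submodule.span ℂ (Set.range b)) {κ : (Fin g → ℕ) → E → ℂ} (hκ : IsFockData Φ η χ b κ)
    (v : E) : HasSum (fun α ↦ fockOp η b α (κ α) v) (fockSeries η b κ v) :=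
  (hκ.summable_apply hη hχ hb hpos hspan v).hasSum

/-- **The Fock series is additive in the data.** [cite: Folland1989, §1.7 Lemma (1.85)] -/
theorem IsFockData.fockSeries_add (hη : IsNSForm Φ η) (hχ : IsSemicharacter Φ η χ)
    (hb : ∀ μ ν, μ ≠ ν → hermOf η (b μ) (b ν) = 0) (hpos : ∀ ν, 0 < frameDiag η b ν)
    (hspan : ∀ w, w ∈ Submodule.span ℂ (Set.range b)) {κ κ' : (Fin g → ℕ) → E → ℂ} (hκ : IsFockData Φ η χ b κ)
    (hκ' : IsFockData Φ η χ b κ') : fockSeries η b (κ + κ') = fockSeries η b κ + fockSeries η b κ' := by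
  funext v
  rw [Pi.add_apply, fockSeries_apply, fockSeries_apply, fockSeries_apply,
    ← (hκ.summable_apply hη hχ hb hpos hspan v).tsum_add (hκ'.summable_apply hη hχ hb hpos hspan v)]
  exact tsum_congr fun α ↦ by rw [Pi.add_apply, fockOp_add_fun hη.type_one_one b α (hκ.contDiff α) (hκ'.contDiff α), Pi.add_apply]

omit [Fintype ι] [FiniteDimensional ℂ E] in
/-- **The Fock series is homogeneous in the data.** [cite: Folland1989, §1.7 Lemma (1.85)] -/
theorem fockSeries_smul (h11 : ∀ u v : E, η ![I • u, I • v] = η ![u, v]) (c : ℂ) {κ : (Fin g → ℕ) → E → ℂ}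
    (hκ : ∀ α, ContDiff ℝ ∞ (κ α)) : fockSeries η b (c • κ) = c • fockSeries η b κ := by
  funext v
  rw [Pi.smul_apply, fockSeries_apply, fockSeries_apply, smul_eq_mul, ← tsum_mul_left]
  exact tsum_congr fun α ↦ by rw [Pi.smul_apply, fockOp_const_smul h11 c b α (hκ α), Pi.smul_apply, smul_eq_mul]

/-- **The Fock series of finite combinations of data.** [cite: Folland1989, §1.7 Lemma (1.85)] -/
theorem IsFockData.fockSeries_finset_sum_smul (hη : IsNSForm Φ η) (hχ : IsSemicharacter Φ η χ)
    (hb : ∀ μ ν, μ ≠ ν → hermOf η (b μ) (b ν) = 0) (hpos : ∀ ν, 0 < frameDiag η b ν)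
    (hspan : ∀ w, w ∈ Submodule.span ℂ (Set.range b)) {σ : Type*} (s : Finset σ) (c : σ → ℂ)
    {κ : σ → (Fin g → ℕ) → E → ℂ} (hκ : ∀ i, IsFockData Φ η χ b (κ i)) :
    fockSeries η b (∑ i ∈ s, c i • κ i) = ∑ i ∈ s, c i • fockSeries η b (κ i) := by
  classical
  induction s using Finset.induction_on with
  | empty =>
    funext v
    simp [fockSeries_apply, fockOp_zero_fun hη.type_one_one]
  | insert a s ha ih =>
    rw [Finset.sum_insert ha, Finset.sum_insert ha, ← ih,
      IsFockData.fockSeries_add hη hχ hb hpos hspan ((hκ a).smul (c a))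
        (IsFockData.finset_sum_smul hη hχ s c hκ),
      fockSeries_smul hη.type_one_one (c a) (hκ a).contDiff]

/-! ### The functional equation -/

/-- **The Fock series satisfies the functional equation of `L(H, χ)`** (termwise).
[cite: Lange2023AbelianVarietiesComplex, §1.6.1 p0063] -/
theorem IsFockData.fockSeries_add_latticeVec (hη : IsNSForm Φ η) {κ : (Fin g → ℕ) → E → ℂ}
    (hκ : IsFockData Φ η χ b κ) (n : ι → ℤ) (v : E) :
    fockSeries η b κ (v + latticeVec Φ n) = canonicalFactor Φ η χ n v * fockSeries η b κ v := by
  rw [fockSeries_apply, fockSeries_apply, ← tsum_mul_left]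
  exact tsum_congr fun α ↦ (fockOp_mem_smoothTheta_of_mem_thetaFunctions hη (hκ.mem α) α).2 n v

end Series

/-! ## §3 Termwise derivatives: `D_w ψ = ∂̄_w ψ − δ̄_w ψ + π H(w,·) ψ` and operator-norm bounds on balls -/

section Derivative

variable {ι : Type*} [Fintype ι] {E : Type*} [NormedAddCommGroup E] [NormedSpace ℂ E] [FiniteDimensional ℂ E]
  {Φ : (ι → ℝ) ≃L[ℝ] E} {η : E [⋀^Fin 2]→L[ℝ] ℝ} {χ : (ι → ℤ) → ℂ} {g : ℕ}

omit [Fintype ι] [FiniteDimensional ℂ E] in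
/-- **`D_w ψ (x) = ∂̄_w ψ (x) − δ̄_w ψ (x) + π H(w, x) ψ(x)`** (`D_w = ∂_w + ∂̄_w` and `δ̄_w = −∂_w + π H(w, ·)`).
[cite: Lange2023AbelianVarietiesComplex, §1.6.1 Lemma 1.6.2] -/
theorem fderiv_apply_eq_dbarAlong_sub_deltaBar (w : E) (ψ : E → ℂ) (x : E) :
    fderiv ℝ ψ x w = dbarAlong w ψ x - deltaBar η w ψ x + π * hermOf η w x * ψ x := by
  rw [fderiv_apply_eq_delAlong_add_dbarAlong, deltaBar_apply]
  ring

omit [Fintype ι] [NormedSpace ℂ E] [FiniteDimensional ℂ E] in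
/-- `|η(u, v)| ≤ ‖η‖ ‖u‖ ‖v‖`. [folklore] -/
private theorem abs_apply_two_le [NormedSpace ℝ E] (η : E [⋀^Fin 2]→L[ℝ] ℝ) (u v : E) :
    |η ![u, v]| ≤ ‖η‖ * ‖u‖ * ‖v‖ := by
  have h := η.le_opNorm ![u, v]
  simp only [Fin.prod_univ_two, Matrix.cons_val_zero, Matrix.cons_val_one, Matrix.cons_val_fin_one,
    Real.norm_eq_abs] at h
  rw [mul_assoc]
  exact h

omit [Fintype ι] [FiniteDimensional ℂ E] in
/-- **The weight on balls**: `e^{-π H(x,x)} ≥ e^{-π ‖η‖ R²}` for `‖x‖ ≤ R`. [cite: Lange2023AbelianVarietiesComplex, §1.6.1 (1.24)] -/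
theorem exp_neg_le_ahWeight {x : E} {R : ℝ} (hx : ‖x‖ ≤ R) :
    Real.exp (-(π * ‖η‖ * R ^ 2)) ≤ ahWeight η x := by
  rw [ahWeight_apply]
  refine Real.exp_le_exp.2 (neg_le_neg ?_)
  have h1 : η ![I • x, x] ≤ ‖η‖ * ‖x‖ * ‖x‖ := by
    have h := abs_apply_two_le η (I • x) x
    rw [norm_smul, Complex.norm_I, one_mul] at h
    exact (le_abs_self _).trans h
  have hR : 0 ≤ R := (norm_nonneg x).trans hx
  have h2 : ‖η‖ * ‖x‖ * ‖x‖ ≤ ‖η‖ * R * R :=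
    mul_le_mul (mul_le_mul_of_nonneg_left hx (norm_nonneg _)) hx (norm_nonneg _) (mul_nonneg (norm_nonneg _) hR)
  nlinarith [Real.pi_pos, norm_nonneg η, norm_nonneg x]

omit [Fintype ι] [FiniteDimensional ℂ E] in
/-- `1/√(e^{-πH(x,x)}) ≤ e^{π‖η‖R²/2}` on the ball of radius `R`. [cite: Lange2023AbelianVarietiesComplex, §1.6.1 (1.24)] -/
theorem inv_sqrt_ahWeight_le {x : E} {R : ℝ} (hx : ‖x‖ ≤ R) :
    (Real.sqrt (ahWeight η x))⁻¹ ≤ Real.exp (π * ‖η‖ * R ^ 2 / 2) := by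
  have hw : 0 < Real.sqrt (ahWeight η x) := Real.sqrt_pos.2 (ahWeight_pos η x)
  rw [inv_le_comm₀ hw (Real.exp_pos _), ← Real.exp_neg]
  have : Real.sqrt (Real.exp (-(π * ‖η‖ * R ^ 2))) = Real.exp (-(π * ‖η‖ * R ^ 2 / 2)) := by
    rw [Real.sqrt_eq_iff_mul_self_eq_of_pos (Real.exp_pos _), ← Real.exp_add]
    ring_nf
  rw [← this]
  exact Real.sqrt_le_sqrt (exp_neg_le_ahWeight hx)

omit [Fintype ι] [FiniteDimensional ℂ E] in
/-- `|H(w, x)| ≤ 2 ‖η‖ ‖w‖ ‖x‖`. [cite: Lange2023AbelianVarietiesComplex, §1.2.2 Lemma 1.2.10] -/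
theorem norm_hermOf_le (w x : E) : ‖hermOf η w x‖ ≤ 2 * ‖η‖ * ‖w‖ * ‖x‖ := by
  rw [hermOf]
  refine (norm_add_le _ _).trans ?_
  rw [norm_mul, Complex.norm_I, mul_one, Complex.norm_real, Complex.norm_real, Real.norm_eq_abs, Real.norm_eq_abs]
  have h1 := abs_apply_two_le η (I • w) x
  rw [norm_smul, Complex.norm_I, one_mul] at h1
  have h2 := abs_apply_two_le η w x
  linarith

/-- **The frame-coordinate constant** `c(e) = Σ_ν ‖e_ν^*‖ √(π h_ν)` of a `ℂ`-basis `e`: it bounds the letter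
constant `Σ_ν |d_ν(w)| √(π h_ν) ≤ c(e) ‖w‖` of row A2-91. [cite: Folland1989, §1.7 (1.82)] -/
def coordConst (η : E [⋀^Fin 2]→L[ℝ] ℝ) (bB : Module.Basis (Fin g) ℂ E) : ℝ :=
  ∑ ν, ‖LinearMap.toContinuousLinearMap (bB.coord ν)‖ * Real.sqrt (π * frameDiag η bB ν)

omit [Fintype ι] in
/-- `c(e) ≥ 0`. [cite: Folland1989, §1.7 (1.82)] -/
theorem coordConst_nonneg (bB : Module.Basis (Fin g) ℂ E) : 0 ≤ coordConst η bB :=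
  Finset.sum_nonneg fun _ _ ↦ mul_nonneg (norm_nonneg _) (Real.sqrt_nonneg _)

omit [Fintype ι] in
/-- `Σ_ν |e_ν^*(w)| √(π h_ν) ≤ c(e) ‖w‖`. [cite: Folland1989, §1.7 (1.82)] -/
theorem sum_norm_coord_mul_sqrt_le (bB : Module.Basis (Fin g) ℂ E) (w : E) :
    ∑ ν, ‖bB.repr w ν‖ * Real.sqrt (π * frameDiag η bB ν) ≤ coordConst η bB * ‖w‖ := by
  rw [coordConst, Finset.sum_mul]
  refine Finset.sum_le_sum fun ν _ ↦ ?_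
  have h : ‖bB.repr w ν‖ ≤ ‖LinearMap.toContinuousLinearMap (bB.coord ν)‖ * ‖w‖ := by
    have := (LinearMap.toContinuousLinearMap (bB.coord ν)).le_opNorm w
    rwa [LinearMap.coe_toContinuousLinearMap', Module.Basis.coord_apply] at this
  calc ‖bB.repr w ν‖ * Real.sqrt (π * frameDiag η bB ν)
      ≤ (‖LinearMap.toContinuousLinearMap (bB.coord ν)‖ * ‖w‖) * Real.sqrt (π * frameDiag η bB ν) :=
        mul_le_mul_of_nonneg_right h (Real.sqrt_nonneg _)
    _ = _ := by ring

/-- **Weighted bound for a letter applied to a Fock state**: for `θ ∈ H⁰(L(H, χ))`, a direction `w` and a letter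
`ℓ ∈ {∂̄_w, δ̄_w}`, `|ℓ(δ̄^α θ)(x)| e^{-πH(x,x)/2} ≤ K (|α| + 2)^{2 rk Λ} c(e) ‖w‖ (|α| + 1) √N(α) ‖θ‖`.
[cite: Folland1989, §1.7 Lemma (1.85)] -/
theorem IsNSForm.exists_norm_ladderWord_fockOp_mul_sqrt_ahWeight_le (hη : IsNSForm Φ η) (bB : Module.Basis (Fin g) ℂ E)
    (hb : ∀ μ ν, μ ≠ ν → hermOf η (bB μ) (bB ν) = 0) (hpos : ∀ ν, 0 < frameDiag η bB ν) :
    ∃ K : ℝ, 0 < K ∧ ∀ {χ : (ι → ℤ) → ℂ}, IsSemicharacter Φ η χ → ∀ {θ : E → ℂ},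
      θ ∈ thetaFunctions Φ (canonicalFactor Φ η χ) → ∀ (ε : Bool) (w : E) (α : Fin g → ℕ) (x : E),
        ‖ladderWord η [(ε, w)] (fockOp η bB α θ) x‖ * Real.sqrt (ahWeight η x) ≤
          K * (((∑ i, α i : ℕ) : ℝ) + 2) ^ (2 * Fintype.card ι) * (coordConst η bB * ‖w‖) * ((((∑ i, α i : ℕ) : ℝ) + 1) *
            (Real.sqrt (fockNormSq η bB α) * ahNorm Φ η θ)) := by
  have hspan : ∀ w, w ∈ Submodule.span ℂ (Set.range bB) := fun w ↦ bB.mem_span w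
  obtain ⟨K, hK, hKb⟩ := hη.exists_norm_fockSum_mul_sqrt_ahWeight_le hb hpos hspan
  refine ⟨K, hK, fun {χ} hχ {θ} hθ ε w α x ↦ ?_⟩
  -- `ℓ(δ̄^α θ)` is a standard Fock sum of degree `|α| + 1`
  obtain ⟨⟨κ', hκ', hrepr⟩, hnorm⟩ :=
    ladderWord_singleton_fockSum_of_coords hη hb hpos (fun ν ↦ bB.repr w ν) hχ ε (∑ i, α i) (single_data_mem hθ α)
  rw [Module.Basis.sum_repr, fockSum_single hη.type_one_one] at hrepr hnorm
  have hn1 : ahNorm Φ η (fockOp η bB α θ) = Real.sqrt (fockNormSq η bB α) * ahNorm Φ η θ := by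
    rw [← fockSum_single hη.type_one_one α θ, ← Real.sqrt_sq (ahNorm_nonneg Φ η (fockSum η bB _ _)),
      ahNorm_sq_fockSum_single hη hχ hb hθ α, Real.sqrt_mul (fockNormSq_pos η bB hpos α).le,
      Real.sqrt_sq (ahNorm_nonneg Φ η θ)]
  rw [hn1] at hnorm
  have h1 := hKb hχ (∑ i, α i + 1) κ' hκ' x
  rw [← hrepr] at h1
  refine h1.trans ?_
  have hcoord := sum_norm_coord_mul_sqrt_le (η := η) bB w
  have h0 : 0 ≤ Real.sqrt (fockNormSq η bB α) * ahNorm Φ η θ := mul_nonneg (Real.sqrt_nonneg _) (ahNorm_nonneg Φ η _)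
  calc K * (((∑ i, α i + 1 : ℕ) : ℝ) + 1) ^ (2 * Fintype.card ι) * ahNorm Φ η (ladderWord η [(ε, w)] (fockOp η bB α θ))
      ≤ K * (((∑ i, α i + 1 : ℕ) : ℝ) + 1) ^ (2 * Fintype.card ι) *
          ((∑ ν, ‖bB.repr w ν‖ * Real.sqrt (π * frameDiag η bB ν)) * ((∑ i, α i : ℕ) + 1) *
            (Real.sqrt (fockNormSq η bB α) * ahNorm Φ η θ)) :=
        mul_le_mul_of_nonneg_left hnorm (by positivity)
    _ ≤ K * (((∑ i, α i + 1 : ℕ) : ℝ) + 1) ^ (2 * Fintype.card ι) *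
          ((coordConst η bB * ‖w‖) * ((∑ i, α i : ℕ) + 1) * (Real.sqrt (fockNormSq η bB α) * ahNorm Φ η θ)) :=
        mul_le_mul_of_nonneg_left (mul_le_mul_of_nonneg_right
          (mul_le_mul_of_nonneg_right hcoord (by positivity)) h0) (by positivity)
    _ = _ := by push_cast; ring

/-- **Operator-norm bound for the derivative of a Fock state on a ball**: for `‖x‖ ≤ R`,
`‖D(δ̄^α θ)(x)‖ ≤ e^{π‖η‖R²/2} (2 K c(e) + 2 π ‖η‖ R K) (|α| + 2)^{2 rk Λ + 1} √N(α) ‖θ‖`.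
[cite: Folland1989, §1.7 Lemma (1.85)] -/
theorem IsNSForm.exists_norm_fderiv_fockOp_le (hη : IsNSForm Φ η) (bB : Module.Basis (Fin g) ℂ E)
    (hb : ∀ μ ν, μ ≠ ν → hermOf η (bB μ) (bB ν) = 0) (hpos : ∀ ν, 0 < frameDiag η bB ν) :
    ∃ K : ℝ, 0 < K ∧ ∀ {χ : (ι → ℤ) → ℂ}, IsSemicharacter Φ η χ → ∀ {θ : E → ℂ},
      θ ∈ thetaFunctions Φ (canonicalFactor Φ η χ) → ∀ (α : Fin g → ℕ) (R : ℝ), 0 ≤ R → ∀ x : E, ‖x‖ ≤ R →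
        ‖fderiv ℝ (fockOp η bB α θ) x‖ ≤
          Real.exp (π * ‖η‖ * R ^ 2 / 2) * (K * (coordConst η bB + R + 1)) *
            ((((∑ i, α i : ℕ) : ℝ) + 2) ^ (2 * Fintype.card ι + 1) * (Real.sqrt (fockNormSq η bB α) * ahNorm Φ η θ)) := by
  have hspan : ∀ w, w ∈ Submodule.span ℂ (Set.range bB) := fun w ↦ bB.mem_span w
  obtain ⟨K₁, hK₁, hK₁b⟩ := hη.exists_norm_ladderWord_fockOp_mul_sqrt_ahWeight_le bB hb hpos
  obtain ⟨K₂, hK₂, hK₂b⟩ := hη.exists_norm_fockOp_mul_sqrt_ahWeight_le hb hpos hspan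
  refine ⟨2 * K₁ + 2 * π * ‖η‖ * K₂, by positivity, fun {χ} hχ {θ} hθ α R hR x hx ↦ ?_⟩
  set A : ℝ := ((∑ i, α i : ℕ) : ℝ) with hA
  have hA0 : 0 ≤ A := Nat.cast_nonneg _
  set s : ℝ := Real.sqrt (fockNormSq η bB α) * ahNorm Φ η θ with hs
  have hs0 : 0 ≤ s := mul_nonneg (Real.sqrt_nonneg _) (ahNorm_nonneg Φ η _)
  have hw : 0 < Real.sqrt (ahWeight η x) := Real.sqrt_pos.2 (ahWeight_pos η x)
  have hc0 := coordConst_nonneg (η := η) bB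
  -- the directional bound, with the weight
  have hdir : ∀ w : E, ‖fderiv ℝ (fockOp η bB α θ) x w‖ * Real.sqrt (ahWeight η x) ≤
      ‖w‖ * ((2 * K₁ * coordConst η bB + 2 * π * ‖η‖ * R * K₂) * ((A + 2) ^ (2 * Fintype.card ι) * (A + 1) * s)) := by
    intro w
    rw [fderiv_apply_eq_dbarAlong_sub_deltaBar (η := η)]
    have e1 := hK₁b hχ hθ true w α x
    have e2 := hK₁b hχ hθ false w α x
    simp only [ladderWord_cons_true, ladderWord_cons_false, ladderWord_nil] at e1 e2
    have e3 : ‖(π : ℂ) * hermOf η w x * fockOp η bB α θ x‖ * Real.sqrt (ahWeight η x) ≤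
        π * ((2 * ‖η‖ * ‖w‖ * ‖x‖) * (K₂ * (A + 1) ^ (2 * Fintype.card ι) * s)) := by
      rw [norm_mul, norm_mul, Complex.norm_real, Real.norm_eq_abs, abs_of_pos Real.pi_pos, mul_assoc, mul_assoc]
      refine mul_le_mul_of_nonneg_left ?_ Real.pi_pos.le
      exact mul_le_mul (norm_hermOf_le w x) (hK₂b hχ hθ α x) (by positivity) (by positivity)
    have hx' : ‖x‖ ≤ R := hx
    calc ‖dbarAlong w (fockOp η bB α θ) x - deltaBar η w (fockOp η bB α θ) x + ↑π * hermOf η w x * fockOp η bB α θ x‖ *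
          Real.sqrt (ahWeight η x)
        ≤ (‖dbarAlong w (fockOp η bB α θ) x‖ + ‖deltaBar η w (fockOp η bB α θ) x‖ +
            ‖(π : ℂ) * hermOf η w x * fockOp η bB α θ x‖) * Real.sqrt (ahWeight η x) :=
          mul_le_mul_of_nonneg_right ((norm_add_le _ _).trans (add_le_add (norm_sub_le _ _) le_rfl)) hw.le
      _ ≤ K₁ * (A + 2) ^ (2 * Fintype.card ι) * (coordConst η bB * ‖w‖) * ((A + 1) * s) +
            K₁ * (A + 2) ^ (2 * Fintype.card ι) * (coordConst η bB * ‖w‖) * ((A + 1) * s) +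
            π * ((2 * ‖η‖ * ‖w‖ * ‖x‖) * (K₂ * (A + 1) ^ (2 * Fintype.card ι) * s)) := by
          rw [add_mul, add_mul]; exact add_le_add (add_le_add e1 e2) e3
      _ ≤ K₁ * (A + 2) ^ (2 * Fintype.card ι) * (coordConst η bB * ‖w‖) * ((A + 1) * s) +
            K₁ * (A + 2) ^ (2 * Fintype.card ι) * (coordConst η bB * ‖w‖) * ((A + 1) * s) +
            π * ((2 * ‖η‖ * ‖w‖ * R) * (K₂ * ((A + 2) ^ (2 * Fintype.card ι) * (A + 1)) * s)) := by
          have hp1 : (A + 1) ^ (2 * Fintype.card ι) ≤ (A + 2) ^ (2 * Fintype.card ι) * (A + 1) := by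
            calc (A + 1) ^ (2 * Fintype.card ι) ≤ (A + 2) ^ (2 * Fintype.card ι) :=
                  pow_le_pow_left₀ (by positivity) (by linarith) _
              _ ≤ (A + 2) ^ (2 * Fintype.card ι) * (A + 1) := le_mul_of_one_le_right (by positivity) (by linarith)
          have : π * ((2 * ‖η‖ * ‖w‖ * ‖x‖) * (K₂ * (A + 1) ^ (2 * Fintype.card ι) * s)) ≤
              π * ((2 * ‖η‖ * ‖w‖ * R) * (K₂ * ((A + 2) ^ (2 * Fintype.card ι) * (A + 1)) * s)) :=
            mul_le_mul_of_nonneg_left (mul_le_mul (mul_le_mul_of_nonneg_left hx' (by positivity))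
              (mul_le_mul_of_nonneg_right (mul_le_mul_of_nonneg_left hp1 hK₂.le) hs0) (by positivity) (by positivity))
              Real.pi_pos.le
          linarith
      _ = ‖w‖ * ((2 * K₁ * coordConst η bB + 2 * π * ‖η‖ * R * K₂) * ((A + 2) ^ (2 * Fintype.card ι) * (A + 1) * s)) := by
          ring
  -- remove the weight and pass to the operator norm
  have hB0 : 0 ≤ (2 * K₁ * coordConst η bB + 2 * π * ‖η‖ * R * K₂) * ((A + 2) ^ (2 * Fintype.card ι) * (A + 1) * s) := by
    positivity
  have hop : ‖fderiv ℝ (fockOp η bB α θ) x‖ ≤ (Real.sqrt (ahWeight η x))⁻¹ *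
      ((2 * K₁ * coordConst η bB + 2 * π * ‖η‖ * R * K₂) * ((A + 2) ^ (2 * Fintype.card ι) * (A + 1) * s)) := by
    refine ContinuousLinearMap.opNorm_le_bound _ (mul_nonneg (inv_nonneg.2 hw.le) hB0) fun w ↦ ?_
    rw [show (Real.sqrt (ahWeight η x))⁻¹ *
        ((2 * K₁ * coordConst η bB + 2 * π * ‖η‖ * R * K₂) * ((A + 2) ^ (2 * Fintype.card ι) * (A + 1) * s)) * ‖w‖ =
        ‖w‖ * ((2 * K₁ * coordConst η bB + 2 * π * ‖η‖ * R * K₂) * ((A + 2) ^ (2 * Fintype.card ι) * (A + 1) * s)) /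
          Real.sqrt (ahWeight η x) by rw [div_eq_mul_inv]; ring, le_div_iff₀ hw]
    exact hdir w
  refine hop.trans ?_
  have hinv := inv_sqrt_ahWeight_le (η := η) hx
  calc (Real.sqrt (ahWeight η x))⁻¹ *
        ((2 * K₁ * coordConst η bB + 2 * π * ‖η‖ * R * K₂) * ((A + 2) ^ (2 * Fintype.card ι) * (A + 1) * s))
      ≤ Real.exp (π * ‖η‖ * R ^ 2 / 2) *
        ((2 * K₁ * coordConst η bB + 2 * π * ‖η‖ * R * K₂) * ((A + 2) ^ (2 * Fintype.card ι) * (A + 1) * s)) :=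
        mul_le_mul_of_nonneg_right hinv hB0
    _ ≤ Real.exp (π * ‖η‖ * R ^ 2 / 2) *
        (((2 * K₁ + 2 * π * ‖η‖ * K₂) * (coordConst η bB + R + 1)) * ((A + 2) ^ (2 * Fintype.card ι) * (A + 2) * s)) := by
        refine mul_le_mul_of_nonneg_left ?_ (Real.exp_pos _).le
        refine mul_le_mul ?_ (mul_le_mul_of_nonneg_right (mul_le_mul_of_nonneg_left (by linarith) (by positivity)) hs0)
          (by positivity) (mul_nonneg (by positivity) (by linarith))
        have t1 : 0 ≤ K₁ * R := mul_nonneg hK₁.le hR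
        have t2 : 0 ≤ π * ‖η‖ * K₂ * coordConst η bB := mul_nonneg (by positivity) hc0
        have t3 : 0 ≤ π * ‖η‖ * K₂ := by positivity
        nlinarith [t1, t2, t3, hK₁.le]
    _ = _ := by rw [pow_succ]; ring

end Derivative

/-! ## §4 Differentiability of the Fock series and termwise differentiation -/

section Differentiability

variable {ι : Type*} [Fintype ι] {E : Type*} [NormedAddCommGroup E] [NormedSpace ℂ E] [FiniteDimensional ℂ E]
  {Φ : (ι → ℝ) ≃L[ℝ] E} {η : E [⋀^Fin 2]→L[ℝ] ℝ} {χ : (ι → ℤ) → ℂ} {g : ℕ} {bB : Module.Basis (Fin g) ℂ E}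

/-- **Termwise differentiation of the Fock series** (Weierstrass M-test for the derivatives on balls,
`hasFDerivAt_tsum_of_isPreconnected`): the series `Σ_α δ̄^α κ_α` of Fock data is differentiable with derivative
`Σ_α D(δ̄^α κ_α)`, the series of derivatives converging absolutely in operator norm. [cite: Folland1989, §1.7 Lemma (1.85)] -/
theorem IsFockData.hasFDerivAt_fockSeries_and_summable (hη : IsNSForm Φ η) (hχ : IsSemicharacter Φ η χ)
    (hb : ∀ μ ν, μ ≠ ν → hermOf η (bB μ) (bB ν) = 0) (hpos : ∀ ν, 0 < frameDiag η bB ν)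
    {κ : (Fin g → ℕ) → E → ℂ} (hκ : IsFockData Φ η χ bB κ) (x : E) :
    HasFDerivAt (fockSeries η bB κ) (∑' α, fderiv ℝ (fockOp η bB α (κ α)) x) x ∧
      Summable fun α ↦ fderiv ℝ (fockOp η bB α (κ α)) x := by
  have hspan : ∀ w, w ∈ Submodule.span ℂ (Set.range bB) := fun w ↦ bB.mem_span w
  obtain ⟨K, hK, hKb⟩ := hη.exists_norm_fderiv_fockOp_le bB hb hpos
  set R : ℝ := ‖x‖ + 1 with hR
  have hR0 : 0 ≤ R := by positivity
  set C : ℝ := Real.exp (π * ‖η‖ * R ^ 2 / 2) * (K * (coordConst η bB + R + 1)) * 2 ^ (2 * Fintype.card ι + 1) with hC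
  have hu : Summable fun α ↦ C * fockWt Φ η bB (2 * Fintype.card ι + 1) κ α := (hκ.rapid _).mul_left C
  have hs : IsOpen (Metric.ball (0 : E) R) := Metric.isOpen_ball
  have hs' : IsPreconnected (Metric.ball (0 : E) R) := (convex_ball (0 : E) R).isPreconnected
  have hf : ∀ α y, y ∈ Metric.ball (0 : E) R →
      HasFDerivAt (fockOp η bB α (κ α)) (fderiv ℝ (fockOp η bB α (κ α)) y) y :=
    fun α y _ ↦ (((fockOp_mem_smoothTheta_of_mem_thetaFunctions hη (hκ.mem α) α).1.differentiable (by simp)) y).hasFDerivAt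
  have hf' : ∀ α y, y ∈ Metric.ball (0 : E) R →
      ‖fderiv ℝ (fockOp η bB α (κ α)) y‖ ≤ C * fockWt Φ η bB (2 * Fintype.card ι + 1) κ α := by
    intro α y hy
    have hy' : ‖y‖ ≤ R := (mem_ball_zero_iff.1 hy).le
    refine (hKb hχ (hκ.mem α) α R hR0 y hy').trans ?_
    rw [hC, fockWt_apply]
    have hA : (0 : ℝ) ≤ ((∑ i, α i : ℕ) : ℝ) := Nat.cast_nonneg _
    have hp : (((∑ i, α i : ℕ) : ℝ) + 2) ^ (2 * Fintype.card ι + 1) ≤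
        2 ^ (2 * Fintype.card ι + 1) * ((((∑ i, α i : ℕ) : ℝ) + 1) ^ (2 * Fintype.card ι + 1)) := by
      rw [← mul_pow]; exact pow_le_pow_left₀ (by positivity) (by linarith) _
    have h0 : 0 ≤ Real.sqrt (fockNormSq η bB α) * ahNorm Φ η (κ α) :=
      mul_nonneg (Real.sqrt_nonneg _) (ahNorm_nonneg Φ η _)
    have hE : 0 ≤ Real.exp (π * ‖η‖ * R ^ 2 / 2) * (K * (coordConst η bB + R + 1)) :=
      mul_nonneg (Real.exp_pos _).le (mul_nonneg hK.le (by linarith [coordConst_nonneg (η := η) bB]))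
    calc Real.exp (π * ‖η‖ * R ^ 2 / 2) * (K * (coordConst η bB + R + 1)) *
          ((((∑ i, α i : ℕ) : ℝ) + 2) ^ (2 * Fintype.card ι + 1) * (Real.sqrt (fockNormSq η bB α) * ahNorm Φ η (κ α)))
        ≤ Real.exp (π * ‖η‖ * R ^ 2 / 2) * (K * (coordConst η bB + R + 1)) *
          ((2 ^ (2 * Fintype.card ι + 1) * (((∑ i, α i : ℕ) : ℝ) + 1) ^ (2 * Fintype.card ι + 1)) *
            (Real.sqrt (fockNormSq η bB α) * ahNorm Φ η (κ α))) :=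
          mul_le_mul_of_nonneg_left (mul_le_mul_of_nonneg_right hp h0) hE
      _ = _ := by ring
  have hx : x ∈ Metric.ball (0 : E) R := by rw [mem_ball_zero_iff, hR]; linarith
  have h0 : (0 : E) ∈ Metric.ball (0 : E) R := Metric.mem_ball_self (by rw [hR]; positivity)
  have hf0 : Summable fun α ↦ fockOp η bB α (κ α) 0 := hκ.summable_apply hη hχ hb hpos hspan 0
  exact ⟨hasFDerivAt_tsum_of_isPreconnected hu hs hs' hf hf' h0 hf0 hx,
    .of_norm_bounded hu fun α ↦ hf' α x hx⟩

/-- The Fock series of Fock data is differentiable. [cite: Folland1989, §1.7 Lemma (1.85)] -/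
theorem IsFockData.differentiable_fockSeries (hη : IsNSForm Φ η) (hχ : IsSemicharacter Φ η χ)
    (hb : ∀ μ ν, μ ≠ ν → hermOf η (bB μ) (bB ν) = 0) (hpos : ∀ ν, 0 < frameDiag η bB ν)
    {κ : (Fin g → ℕ) → E → ℂ} (hκ : IsFockData Φ η χ bB κ) : Differentiable ℝ (fockSeries η bB κ) :=
  fun x ↦ (hκ.hasFDerivAt_fockSeries_and_summable hη hχ hb hpos x).1.differentiableAt

/-- **`D(Σ_α δ̄^α κ_α)(x) w = Σ_α D(δ̄^α κ_α)(x) w`.** [cite: Folland1989, §1.7 Lemma (1.85)] -/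
theorem IsFockData.fderiv_fockSeries_apply (hη : IsNSForm Φ η) (hχ : IsSemicharacter Φ η χ)
    (hb : ∀ μ ν, μ ≠ ν → hermOf η (bB μ) (bB ν) = 0) (hpos : ∀ ν, 0 < frameDiag η bB ν)
    {κ : (Fin g → ℕ) → E → ℂ} (hκ : IsFockData Φ η χ bB κ) (x w : E) :
    fderiv ℝ (fockSeries η bB κ) x w = ∑' α, fderiv ℝ (fockOp η bB α (κ α)) x w ∧
      Summable fun α ↦ fderiv ℝ (fockOp η bB α (κ α)) x w := by
  obtain ⟨h1, h2⟩ := hκ.hasFDerivAt_fockSeries_and_summable hη hχ hb hpos x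
  have h3 := (ContinuousLinearMap.apply ℝ ℂ w).map_tsum h2
  have h4 := (ContinuousLinearMap.apply ℝ ℂ w).summable h2
  simp only [ContinuousLinearMap.apply_apply] at h3
  refine ⟨by rw [h1.fderiv, h3], ?_⟩
  refine h4.congr fun α ↦ ?_
  simp

/-! ## §5 `∂̄_w` and `δ̄_w` of the Fock series are Fock series -/

/-- **`∂̄_w (Σ_α δ̄^α κ_α) = Σ_α ∂̄_w δ̄^α κ_α`** (pointwise). [cite: Folland1989, §1.7 (1.82)] -/
theorem IsFockData.dbarAlong_fockSeries_apply (hη : IsNSForm Φ η) (hχ : IsSemicharacter Φ η χ)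
    (hb : ∀ μ ν, μ ≠ ν → hermOf η (bB μ) (bB ν) = 0) (hpos : ∀ ν, 0 < frameDiag η bB ν)
    {κ : (Fin g → ℕ) → E → ℂ} (hκ : IsFockData Φ η χ bB κ) (w x : E) :
    dbarAlong w (fockSeries η bB κ) x = ∑' α, dbarAlong w (fockOp η bB α (κ α)) x ∧
      Summable fun α ↦ dbarAlong w (fockOp η bB α (κ α)) x := by
  obtain ⟨e1, s1⟩ := hκ.fderiv_fockSeries_apply hη hχ hb hpos x w
  obtain ⟨e2, s2⟩ := hκ.fderiv_fockSeries_apply hη hχ hb hpos x (I • w)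
  have hsum : Summable fun α ↦ dbarAlong w (fockOp η bB α (κ α)) x := by
    have := ((s1.add (s2.mul_left I)).mul_left (2 : ℂ)⁻¹)
    refine this.congr fun α ↦ ?_
    rw [dbarAlong_apply, smul_eq_mul, smul_eq_mul]
  refine ⟨?_, hsum⟩
  rw [dbarAlong_apply, e1, e2, smul_eq_mul, smul_eq_mul, ← tsum_mul_left, ← s1.tsum_add (s2.mul_left I), ← tsum_mul_left]
  exact tsum_congr fun α ↦ by rw [dbarAlong_apply, smul_eq_mul, smul_eq_mul]

/-- **`δ̄_w (Σ_α δ̄^α κ_α) = Σ_α δ̄_w δ̄^α κ_α`** (pointwise). [cite: Folland1989, §1.7 (1.82)] -/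
theorem IsFockData.deltaBar_fockSeries_apply (hη : IsNSForm Φ η) (hχ : IsSemicharacter Φ η χ)
    (hb : ∀ μ ν, μ ≠ ν → hermOf η (bB μ) (bB ν) = 0) (hpos : ∀ ν, 0 < frameDiag η bB ν)
    {κ : (Fin g → ℕ) → E → ℂ} (hκ : IsFockData Φ η χ bB κ) (w x : E) :
    deltaBar η w (fockSeries η bB κ) x = ∑' α, deltaBar η w (fockOp η bB α (κ α)) x ∧
      Summable fun α ↦ deltaBar η w (fockOp η bB α (κ α)) x := by
  have hspan : ∀ w, w ∈ Submodule.span ℂ (Set.range bB) := fun w ↦ bB.mem_span w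
  obtain ⟨e1, s1⟩ := hκ.fderiv_fockSeries_apply hη hχ hb hpos x w
  obtain ⟨e2, s2⟩ := hκ.fderiv_fockSeries_apply hη hχ hb hpos x (I • w)
  have s0 := hκ.summable_apply hη hχ hb hpos hspan x
  have hdel : Summable fun α ↦ delAlong w (fockOp η bB α (κ α)) x := by
    have := ((s1.sub (s2.mul_left I)).mul_left (2 : ℂ)⁻¹)
    refine this.congr fun α ↦ ?_
    rw [delAlong_apply]
  have hsum : Summable fun α ↦ deltaBar η w (fockOp η bB α (κ α)) x := by
    refine (hdel.neg.add (s0.mul_left ((π : ℂ) * hermOf η w x))).congr fun α ↦ ?_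
    rw [deltaBar_apply]
  refine ⟨?_, hsum⟩
  have edel : delAlong w (fockSeries η bB κ) x = ∑' α, delAlong w (fockOp η bB α (κ α)) x := by
    rw [delAlong_apply, e1, e2, ← tsum_mul_left, ← s1.tsum_sub (s2.mul_left I), ← tsum_mul_left]
    exact tsum_congr fun α ↦ by rw [delAlong_apply]
  rw [deltaBar_apply, edel, fockSeries_apply, ← tsum_mul_left, ← tsum_neg, ← hdel.neg.tsum_add (s0.mul_left _)]
  exact tsum_congr fun α ↦ by rw [deltaBar_apply]

/-- **`∂̄_{e_ν} (Σ_α δ̄^α κ_α) = Σ_β δ̄^β (A_ν κ)_β`** — the annihilation letter on a Fock series is the Fock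
series of the annihilation-shifted data (`∂̄_{e_ν} δ̄^α θ = π h_ν α_ν δ̄^{α-1_ν} θ`, reindexed along
`β ↦ β + 1_ν`). [cite: Folland1989, §1.7 (1.82)] -/
theorem IsFockData.dbarAlong_basis_fockSeries (hη : IsNSForm Φ η) (hχ : IsSemicharacter Φ η χ)
    (hb : ∀ μ ν, μ ≠ ν → hermOf η (bB μ) (bB ν) = 0) (hpos : ∀ ν, 0 < frameDiag η bB ν)
    {κ : (Fin g → ℕ) → E → ℂ} (hκ : IsFockData Φ η χ bB κ) (ν : Fin g) :
    dbarAlong (bB ν) (fockSeries η bB κ) = fockSeries η bB (ComplexTorus.annData η bB ν κ) := by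
  funext x
  rw [(hκ.dbarAlong_fockSeries_apply hη hχ hb hpos (bB ν) x).1, fockSeries_apply]
  -- the terms of the left series, supported on `α_ν ≠ 0`
  set F : (Fin g → ℕ) → ℂ := fun α ↦ dbarAlong (bB ν) (fockOp η bB α (κ α)) x with hF
  have hF' : ∀ α, F α = ((π * frameDiag η bB ν * α ν : ℝ) : ℂ) * fockOp η bB (α - Pi.single ν 1) (κ α) x := by
    intro α
    rw [hF]
    dsimp only
    rw [dbarAlong_fockOp_of_mem_thetaFunctions hη hb (hκ.mem α) α ν, Pi.smul_apply, smul_eq_mul]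
  have hsupp : Function.support F ⊆ Set.range fun α : Fin g → ℕ ↦ α + Pi.single ν 1 := by
    intro α hα
    by_cases hne : α ν = 0
    · exact absurd (by rw [hF' α, hne]; push_cast; ring) hα
    · exact ⟨α - Pi.single ν 1, sub_single_add_single' hne⟩
  change ∑' α, F α = _
  rw [← (add_single_injective ν).tsum_eq hsupp]
  refine tsum_congr fun β ↦ ?_
  rw [hF' (β + Pi.single ν 1), add_single_sub_single', add_single_apply_same', annData_apply,
    fockOp_const_smul hη.type_one_one _ _ β (hκ.contDiff _), Pi.smul_apply, smul_eq_mul]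
  push_cast
  ring

/-- **`δ̄_{e_ν} (Σ_α δ̄^α κ_α) = Σ_β δ̄^β (S_ν κ)_β`** — the creation letter on a Fock series is the Fock series
of the creation-shifted data (`δ̄_{e_ν} δ̄^α = δ̄^{α+1_ν}`). [cite: Folland1989, §1.7 (1.82)] -/
theorem IsFockData.deltaBar_basis_fockSeries (hη : IsNSForm Φ η) (hχ : IsSemicharacter Φ η χ)
    (hb : ∀ μ ν, μ ≠ ν → hermOf η (bB μ) (bB ν) = 0) (hpos : ∀ ν, 0 < frameDiag η bB ν)
    {κ : (Fin g → ℕ) → E → ℂ} (hκ : IsFockData Φ η χ bB κ) (ν : Fin g) :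
    deltaBar η (bB ν) (fockSeries η bB κ) = fockSeries η bB (ComplexTorus.creShift ν κ) := by
  funext x
  rw [(hκ.deltaBar_fockSeries_apply hη hχ hb hpos (bB ν) x).1, fockSeries_apply]
  set G : (Fin g → ℕ) → ℂ := fun β ↦ fockOp η bB β (ComplexTorus.creShift ν κ β) x with hG
  have hsupp : Function.support G ⊆ Set.range fun α : Fin g → ℕ ↦ α + Pi.single ν 1 := by
    intro β hβ
    by_cases hne : β ν = 0
    · refine absurd ?_ hβ
      rw [hG]
      dsimp only
      rw [show ComplexTorus.creShift ν κ β = 0 from if_pos hne, fockOp_zero_fun hη.type_one_one]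
      rfl
    · exact ⟨β - Pi.single ν 1, sub_single_add_single' hne⟩
  change _ = ∑' β, G β
  rw [← (add_single_injective ν).tsum_eq hsupp]
  refine tsum_congr fun α ↦ ?_
  rw [hG]
  dsimp only
  rw [creShift_add_single, fockOp_add_single hη.type_one_one _ α ν (hκ.contDiff α)]

/-- **`∂̄_w` of a Fock series is a Fock series**: `∂̄_w Σ_α δ̄^α κ_α = Σ_β δ̄^β (Σ_ν conj(e_ν^*(w)) A_ν κ)_β`.
[cite: Folland1989, §1.7 (1.82)] -/
theorem IsFockData.dbarAlong_fockSeries (hη : IsNSForm Φ η) (hχ : IsSemicharacter Φ η χ)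
    (hb : ∀ μ ν, μ ≠ ν → hermOf η (bB μ) (bB ν) = 0) (hpos : ∀ ν, 0 < frameDiag η bB ν)
    {κ : (Fin g → ℕ) → E → ℂ} (hκ : IsFockData Φ η χ bB κ) (w : E) :
    dbarAlong w (fockSeries η bB κ) = fockSeries η bB (∑ ν, conj (bB.repr w ν) • ComplexTorus.annData η bB ν κ) := by
  have hspan : ∀ w, w ∈ Submodule.span ℂ (Set.range bB) := fun w ↦ bB.mem_span w
  funext x
  rw [IsFockData.fockSeries_finset_sum_smul hη hχ hb hpos hspan _ _ (fun ν ↦ hκ.annData hpos ν), Finset.sum_apply]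
  conv_lhs => rw [← bB.sum_repr w]
  rw [dbarAlong_sum_smul_left]
  exact Finset.sum_congr rfl fun ν _ ↦ by
    rw [hκ.dbarAlong_basis_fockSeries hη hχ hb hpos ν, Pi.smul_apply, smul_eq_mul]

/-- **`δ̄_w` of a Fock series is a Fock series**: `δ̄_w Σ_α δ̄^α κ_α = Σ_β δ̄^β (Σ_ν e_ν^*(w) S_ν κ)_β`.
[cite: Folland1989, §1.7 (1.82)] -/
theorem IsFockData.deltaBar_fockSeries (hη : IsNSForm Φ η) (hχ : IsSemicharacter Φ η χ)
    (hb : ∀ μ ν, μ ≠ ν → hermOf η (bB μ) (bB ν) = 0) (hpos : ∀ ν, 0 < frameDiag η bB ν)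
    {κ : (Fin g → ℕ) → E → ℂ} (hκ : IsFockData Φ η χ bB κ) (w : E) :
    deltaBar η w (fockSeries η bB κ) = fockSeries η bB (∑ ν, bB.repr w ν • ComplexTorus.creShift ν κ) := by
  have hspan : ∀ w, w ∈ Submodule.span ℂ (Set.range bB) := fun w ↦ bB.mem_span w
  funext x
  rw [IsFockData.fockSeries_finset_sum_smul hη hχ hb hpos hspan _ _ (fun ν ↦ hκ.creShift hpos ν), Finset.sum_apply]
  conv_lhs => rw [← bB.sum_repr w]
  rw [deltaBar_sum_smul_left η ((hκ.differentiable_fockSeries hη hχ hb hpos) x)]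
  exact Finset.sum_congr rfl fun ν _ ↦ by
    rw [hκ.deltaBar_basis_fockSeries hη hχ hb hpos ν, Pi.smul_apply, smul_eq_mul]

/-! ## §6 Smoothness of the Fock series and membership in `A^{0,0}(L(H, χ))` -/

/-- **The Fock series of Fock data is `C^n` for every `n`** — induction on `n`: `D_y S = ∂̄_y S − δ̄_y S + π H(y,·) S`
with `∂̄_y S`, `δ̄_y S` again Fock series of Fock data (Mathlib's `contDiff_succ_iff_fderiv_apply`).
[cite: Folland1989, §1.7 Lemma (1.85)] -/
theorem IsFockData.contDiff_fockSeries_nat (hη : IsNSForm Φ η) (hχ : IsSemicharacter Φ η χ)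
    (hb : ∀ μ ν, μ ≠ ν → hermOf η (bB μ) (bB ν) = 0) (hpos : ∀ ν, 0 < frameDiag η bB ν) :
    ∀ (n : ℕ) {κ : (Fin g → ℕ) → E → ℂ}, IsFockData Φ η χ bB κ → ContDiff ℝ n (fockSeries η bB κ)
  | 0, κ, hκ => contDiff_zero.2 (hκ.differentiable_fockSeries hη hχ hb hpos).continuous
  | n + 1, κ, hκ => by
    rw [show ((n + 1 : ℕ) : WithTop ℕ∞) = (n : WithTop ℕ∞) + 1 by push_cast; rfl, contDiff_succ_iff_fderiv_apply]
    refine ⟨hκ.differentiable_fockSeries hη hχ hb hpos, fun h ↦ absurd h (by exact_mod_cast WithTop.coe_ne_top),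
      fun y ↦ ?_⟩
    have hy : (fun x ↦ fderiv ℝ (fockSeries η bB κ) x y) = fun x ↦
        fockSeries η bB (∑ ν, conj (bB.repr y ν) • ComplexTorus.annData η bB ν κ) x -
          fockSeries η bB (∑ ν, bB.repr y ν • ComplexTorus.creShift ν κ) x + π * hermOf η y x * fockSeries η bB κ x := by
      funext x
      rw [fderiv_apply_eq_dbarAlong_sub_deltaBar (η := η), hκ.dbarAlong_fockSeries hη hχ hb hpos y,
        hκ.deltaBar_fockSeries hη hχ hb hpos y]
    rw [hy]
    have h1 := IsFockData.contDiff_fockSeries_nat hη hχ hb hpos n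
      (IsFockData.finset_sum_smul hη hχ Finset.univ (fun ν ↦ conj (bB.repr y ν)) (fun ν ↦ hκ.annData hpos ν))
    have h2 := IsFockData.contDiff_fockSeries_nat hη hχ hb hpos n
      (IsFockData.finset_sum_smul hη hχ Finset.univ (fun ν ↦ bB.repr y ν) (fun ν ↦ hκ.creShift hpos ν))
    have h3 := IsFockData.contDiff_fockSeries_nat hη hχ hb hpos n hκ
    have hH : ContDiff ℝ n (fun x ↦ (π : ℂ) * hermOf η y x) :=
      contDiff_const.mul ((contDiff_hermOf_right hη.type_one_one y).of_le (by exact_mod_cast le_top))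
    exact (h1.sub h2).add (hH.mul h3)

/-- **The Fock series of Fock data is `C^∞`.** [cite: Folland1989, §1.7 Lemma (1.85)] -/
theorem IsFockData.contDiff_fockSeries (hη : IsNSForm Φ η) (hχ : IsSemicharacter Φ η χ)
    (hb : ∀ μ ν, μ ≠ ν → hermOf η (bB μ) (bB ν) = 0) (hpos : ∀ ν, 0 < frameDiag η bB ν)
    {κ : (Fin g → ℕ) → E → ℂ} (hκ : IsFockData Φ η χ bB κ) : ContDiff ℝ ∞ (fockSeries η bB κ) :=
  contDiff_infty.2 fun n ↦ IsFockData.contDiff_fockSeries_nat hη hχ hb hpos n hκ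

/-- **Synthesis: the Fock series of rapidly decreasing `H⁰(L(H, χ))`-valued Fock data is a smooth section of
`L(H, χ)`**, `Σ_α δ̄^α κ_α ∈ A^{0,0}(L(H, χ))`. [cite: Folland1989, §1.7 Lemma (1.85)] -/
theorem IsFockData.fockSeries_mem_smoothTheta (hη : IsNSForm Φ η) (hχ : IsSemicharacter Φ η χ)
    (hb : ∀ μ ν, μ ≠ ν → hermOf η (bB μ) (bB ν) = 0) (hpos : ∀ ν, 0 < frameDiag η bB ν)
    {κ : (Fin g → ℕ) → E → ℂ} (hκ : IsFockData Φ η χ bB κ) :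
    fockSeries η bB κ ∈ smoothTheta Φ (canonicalFactor Φ η χ) :=
  ⟨hκ.contDiff_fockSeries hη hχ hb hpos, hκ.fockSeries_add_latticeVec hη⟩

end Differentiability

/-! ## §7 Inner products of the Fock series: termwise integration and the Fock coefficients -/

section Coefficients

variable {ι : Type*} [Fintype ι] {E : Type*} [NormedAddCommGroup E] [NormedSpace ℂ E] [FiniteDimensional ℂ E]
  {Φ : (ι → ℝ) ≃L[ℝ] E} {η : E [⋀^Fin 2]→L[ℝ] ℝ} {χ : (ι → ℤ) → ℂ} {g : ℕ} {bB : Module.Basis (Fin g) ℂ E}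

omit [FiniteDimensional ℂ E] in
/-- **A uniform weighted bound for a smooth section**: `|u(v)| e^{-πH(v,v)/2} ≤ G` for all `v` (from row A2-90).
[cite: Folland1989, §1.7 Lemma (1.85)] -/
theorem exists_norm_mul_sqrt_ahWeight_le (hη : IsNSForm Φ η) (hχ : IsSemicharacter Φ η χ) {u : E → ℂ}
    (hu : u ∈ smoothTheta Φ (canonicalFactor Φ η χ)) :
    ∃ G : ℝ, 0 ≤ G ∧ ∀ v : E, ‖u v‖ * Real.sqrt (ahWeight η v) ≤ G := by
  classical
  obtain ⟨K, hK, hKb⟩ := hη.exists_norm_sq_mul_ahWeight_le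
  set S : ℝ := ahNorm Φ η u ^ 2 + ∑ j : ι, ((leibnizTerms (latticeDir Φ j) (2 * Fintype.card ι)).map fun t ↦
      ahNorm Φ η (ladderWord η t.2.1 u) * ahNorm Φ η (ladderWord η t.2.2 u)).sum with hS
  have hS0 : 0 ≤ K * S := by
    have h := hKb hχ hu 0
    exact le_trans (mul_nonneg (sq_nonneg _) (ahWeight_pos η 0).le) h
  refine ⟨Real.sqrt (K * S), Real.sqrt_nonneg _, fun v ↦ ?_⟩
  rw [Real.le_sqrt (mul_nonneg (norm_nonneg _) (Real.sqrt_nonneg _)) hS0, mul_pow,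
    Real.sq_sqrt (ahWeight_pos η v).le]
  exact hKb hχ hu v

/-- **Termwise inner products**: `(Σ_α δ̄^α κ_α, g) = Σ_α (δ̄^α κ_α, g)` for `g ∈ A^{0,0}(L(H, χ))` (dominated
convergence on the compact torus: `|⟨δ̄^α κ_α, g⟩| ≤ K w_{2rk Λ}(α) · sup |g| e^{-πH/2}`). [cite: Folland1989, §1.7 Lemma (1.85)] -/
theorem IsFockData.hasSum_ahInner_fockSeries_left (hη : IsNSForm Φ η) (hχ : IsSemicharacter Φ η χ)
    (hb : ∀ μ ν, μ ≠ ν → hermOf η (bB μ) (bB ν) = 0) (hpos : ∀ ν, 0 < frameDiag η bB ν)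
    {κ : (Fin g → ℕ) → E → ℂ} (hκ : IsFockData Φ η χ bB κ) {g' : E → ℂ}
    (hg' : g' ∈ smoothTheta Φ (canonicalFactor Φ η χ)) :
    HasSum (fun α ↦ ahInner Φ η (fockOp η bB α (κ α)) g') (ahInner Φ η (fockSeries η bB κ) g') := by
  have hspan : ∀ w, w ∈ Submodule.span ℂ (Set.range bB) := fun w ↦ bB.mem_span w
  obtain ⟨K, hK, hKb⟩ := hη.exists_norm_fockOp_mul_sqrt_ahWeight_le hb hpos hspan
  obtain ⟨G, hG0, hGb⟩ := exists_norm_mul_sqrt_ahWeight_le hη hχ hg'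
  set F : (Fin g → ℕ) → ComplexTorus Φ → ℂ := fun α x ↦ descendFun Φ (ahPair η (fockOp η bB α (κ α)) g') x with hF
  have hF_int : ∀ α, Integrable (F α) := fun α ↦
    integrable_descendFun_ahPair hη hχ (fockOp_mem_smoothTheta_of_mem_thetaFunctions hη (hκ.mem α) α) hg'
  -- the pointwise bound `‖F α x‖ ≤ K w(α) G`
  have hFle : ∀ α x, ‖F α x‖ ≤ K * fockWt Φ η bB (2 * Fintype.card ι) κ α * G := by
    intro α x
    rw [hF]
    dsimp only
    rw [descendFun_apply, ahPair_apply]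
    set v := extChartAt 𝓘(ℝ, E) x x
    have hw : 0 ≤ ahWeight η v := (ahWeight_pos η v).le
    rw [norm_mul, norm_mul, Complex.norm_conj, Complex.norm_real, Real.norm_eq_abs, abs_of_nonneg hw,
      show ‖fockOp η bB α (κ α) v‖ * ‖g' v‖ * ahWeight η v =
        (‖fockOp η bB α (κ α) v‖ * Real.sqrt (ahWeight η v)) * (‖g' v‖ * Real.sqrt (ahWeight η v)) by
        rw [mul_mul_mul_comm, Real.mul_self_sqrt hw]]
    refine mul_le_mul ?_ (hGb v) (mul_nonneg (norm_nonneg _) (Real.sqrt_nonneg _)) (by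
      exact mul_nonneg hK.le (fockWt_nonneg _ _ _))
    rw [fockWt_apply, ← mul_assoc]
    exact hKb hχ (hκ.mem α) α v
  have hF_sum : Summable fun α ↦ ∫ x, ‖F α x‖ := by
    refine (((hκ.rapid (2 * Fintype.card ι)).mul_left K).mul_right G).of_nonneg_of_le
      (fun α ↦ integral_nonneg fun x ↦ norm_nonneg _) fun α ↦ ?_
    calc ∫ x, ‖F α x‖ ≤ ∫ _ : ComplexTorus Φ, K * fockWt Φ η bB (2 * Fintype.card ι) κ α * G :=
          integral_mono (hF_int α).norm (integrable_const _) fun x ↦ hFle α x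
      _ = K * fockWt Φ η bB (2 * Fintype.card ι) κ α * G := by simp
  have h := hasSum_integral_of_summable_integral_norm hF_int hF_sum
  -- identify the sum of the integrands with the pairing of the series
  have hpt : ∀ x : ComplexTorus Φ, ∑' α, F α x = descendFun Φ (ahPair η (fockSeries η bB κ) g') x := by
    intro x
    rw [descendFun_apply, ahPair_apply, fockSeries_apply, ← tsum_mul_right, ← tsum_mul_right]
    exact tsum_congr fun α ↦ by rw [hF]; rfl
  simp_rw [hpt] at h
  simpa only [ahInner_def] using h

/-- `(Σ_α δ̄^α κ_α, g) = Σ_α (δ̄^α κ_α, g)`. [cite: Folland1989, §1.7 Lemma (1.85)] -/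
theorem IsFockData.ahInner_fockSeries_left (hη : IsNSForm Φ η) (hχ : IsSemicharacter Φ η χ)
    (hb : ∀ μ ν, μ ≠ ν → hermOf η (bB μ) (bB ν) = 0) (hpos : ∀ ν, 0 < frameDiag η bB ν)
    {κ : (Fin g → ℕ) → E → ℂ} (hκ : IsFockData Φ η χ bB κ) {g' : E → ℂ}
    (hg' : g' ∈ smoothTheta Φ (canonicalFactor Φ η χ)) :
    ahInner Φ η (fockSeries η bB κ) g' = ∑' α, ahInner Φ η (fockOp η bB α (κ α)) g' :=
  (hκ.hasSum_ahInner_fockSeries_left hη hχ hb hpos hg').tsum_eq.symm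

/-- **The Fock coefficients of a Fock series**: `(Σ_α δ̄^α κ_α, δ̄^β θ) = N(β) (κ_β, θ)` for `θ ∈ H⁰(L(H, χ))`
(orthogonality of the Fock states). [cite: Folland1989, §1.7 (vii)] -/
theorem IsFockData.ahInner_fockSeries_fockOp (hη : IsNSForm Φ η) (hχ : IsSemicharacter Φ η χ)
    (hb : ∀ μ ν, μ ≠ ν → hermOf η (bB μ) (bB ν) = 0) (hpos : ∀ ν, 0 < frameDiag η bB ν)
    {κ : (Fin g → ℕ) → E → ℂ} (hκ : IsFockData Φ η χ bB κ) {θ : E → ℂ}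
    (hθ : θ ∈ thetaFunctions Φ (canonicalFactor Φ η χ)) (β : Fin g → ℕ) :
    ahInner Φ η (fockSeries η bB κ) (fockOp η bB β θ) = (fockNormSq η bB β : ℂ) * ahInner Φ η (κ β) θ := by
  classical
  have h := hκ.hasSum_ahInner_fockSeries_left hη hχ hb hpos
    (fockOp_mem_smoothTheta_of_mem_thetaFunctions (b := ⇑bB) hη hθ β)
  have h2 : HasSum (fun α ↦ ahInner Φ η (fockOp η bB α (κ α)) (fockOp η bB β θ))
      ((fockNormSq η bB β : ℂ) * ahInner Φ η (κ β) θ) := by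
    have h3 := hasSum_ite_eq β ((fockNormSq η bB β : ℂ) * ahInner Φ η (κ β) θ)
    refine h3.congr_fun fun α ↦ ?_
    rw [ahInner_fockOp_fockOp_of_mem_thetaFunctions hη hχ hb (hκ.mem α) hθ]
    by_cases hαβ : α = β
    · subst hαβ; simp
    · rw [if_neg hαβ, if_neg hαβ]
  exact h.unique h2

/-- **Uniqueness of Fock data from the series** (coefficientwise): if two Fock data have the same Fock series then
`N(β) (κ_β − κ'_β, θ) = 0` for all `θ ∈ H⁰(L(H, χ))`, hence `κ_β = κ'_β` whenever `κ_β − κ'_β ∈ H⁰` is tested against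
itself. [cite: Folland1989, §1.7 (vii)] -/
theorem IsFockData.ahInner_sub_self_eq_zero_of_fockSeries_eq (hη : IsNSForm Φ η) (hχ : IsSemicharacter Φ η χ)
    (hb : ∀ μ ν, μ ≠ ν → hermOf η (bB μ) (bB ν) = 0) (hpos : ∀ ν, 0 < frameDiag η bB ν)
    {κ κ' : (Fin g → ℕ) → E → ℂ} (hκ : IsFockData Φ η χ bB κ) (hκ' : IsFockData Φ η χ bB κ')
    (heq : fockSeries η bB κ = fockSeries η bB κ') (β : Fin g → ℕ) :
    ahInner Φ η (κ β - κ' β) (κ β - κ' β) = 0 := by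
  have hmem : κ β - κ' β ∈ thetaFunctions Φ (canonicalFactor Φ η χ) := sub_mem (hκ.mem β) (hκ'.mem β)
  have h1 := hκ.ahInner_fockSeries_fockOp hη hχ hb hpos hmem β
  have h2 := hκ'.ahInner_fockSeries_fockOp hη hχ hb hpos hmem β
  rw [heq] at h1
  have h3 : (fockNormSq η bB β : ℂ) * (ahInner Φ η (κ β) (κ β - κ' β) - ahInner Φ η (κ' β) (κ β - κ' β)) = 0 := by
    rw [mul_sub, ← h1, ← h2, sub_self]
  have hN : (fockNormSq η bB β : ℂ) ≠ 0 := by exact_mod_cast (fockNormSq_pos η bB hpos β).ne'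
  have h4 := (mul_eq_zero.1 h3).resolve_left hN
  rwa [← ahInner_sub_left hη hχ (thetaFunctions_le_smoothTheta _ (hκ.mem β))
    (thetaFunctions_le_smoothTheta _ (hκ'.mem β)) (thetaFunctions_le_smoothTheta _ hmem)] at h4

end Coefficients

/-! # Part B — Analysis: the Fock data of a smooth section and the expansion theorem -/

/-! ## §8 Vanishing of all Fock coefficients forces vanishing -/

section Uniqueness

variable {ι : Type*} [Fintype ι] {E : Type*} [NormedAddCommGroup E] [NormedSpace ℂ E] [FiniteDimensional ℂ E]
  {Φ : (ι → ℝ) ≃L[ℝ] E} {η : E [⋀^Fin 2]→L[ℝ] ℝ} {χ : (ι → ℤ) → ℂ} {g : ℕ} {b : Fin g → E}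

omit [Fintype ι] [FiniteDimensional ℂ E] in
/-- `δ̄_y^N u` is the ladder word `(δ̄_y)^N` applied to `u`. [cite: Lange2023AbelianVarietiesComplex, §1.6.1 Lemma 1.6.2] -/
theorem iterate_deltaBar_eq_ladderWord (y : E) : ∀ (N : ℕ) (u : E → ℂ),
    (deltaBar η y)^[N] u = ladderWord η (List.replicate N (false, y)) u
  | 0, u => rfl
  | N + 1, u => by
    rw [Function.iterate_succ_apply', List.replicate_succ, ladderWord_cons_false, iterate_deltaBar_eq_ladderWord y N u]

/-- **`δ̄_y^N θ` is a standard Fock sum of degree `N`** with `H⁰(L(H, χ))`-valued data, for `θ ∈ H⁰(L(H, χ))` and a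
spanning `H`-orthogonal frame. [cite: Folland1989, §1.7 (1.82)] -/
theorem exists_iterate_deltaBar_eq_fockSum (hη : IsNSForm Φ η) (hχ : IsSemicharacter Φ η χ)
    (hb : ∀ μ ν, μ ≠ ν → hermOf η (b μ) (b ν) = 0) (hpos : ∀ ν, 0 < frameDiag η b ν)
    (hspan : ∀ w, w ∈ Submodule.span ℂ (Set.range b)) {θ : E → ℂ}
    (hθ : θ ∈ thetaFunctions Φ (canonicalFactor Φ η χ)) (y : E) (N : ℕ) :
    ∃ κ : (Fin g → ℕ) → E → ℂ, (∀ α, κ α ∈ thetaFunctions Φ (canonicalFactor Φ η χ)) ∧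
      (deltaBar η y)^[N] θ = fockSum η b N κ := by
  classical
  obtain ⟨C, -, hC⟩ := exists_ladderWord_fockSum hη hb hpos hspan y
  have hP : ∀ p ∈ List.replicate N (false, y), p.2 = y := by
    intro p hp; rw [List.eq_of_mem_replicate hp]
  obtain ⟨⟨κ, hκ, hrepr⟩, -⟩ := hC hχ (List.replicate N (false, y)) hP (∑ i, (0 : Fin g → ℕ) i)
    (fun β ↦ if β = 0 then θ else 0) (single_data_mem hθ 0)
  refine ⟨κ, hκ, ?_⟩
  rw [iterate_deltaBar_eq_ladderWord, ← fockOp_zero (η := η) b θ, ← fockSum_single hη.type_one_one 0 θ, hrepr,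
    List.length_replicate]
  simp

/-- **A smooth section with vanishing Fock coefficients vanishes**: for a Riemann form `H`, if
`f ∈ A^{0,0}(L(H, χ))` satisfies `(f, δ̄^β θ) = 0` for all multi-indices `β` and all `θ ∈ H⁰(L(H, χ))` (Fock states
along a spanning `H`-orthogonal frame), then `f = 0` — Stage 2 (coherent-state completeness) + the closure of
standard Fock sums under `δ̄_y`. [cite: Folland1989, §1.7 (vii)] -/
theorem IsRiemannForm.eq_zero_of_forall_ahInner_fockOp_eq_zero (hη : IsRiemannForm Φ η) (hχ : IsSemicharacter Φ η χ)
    (hb : ∀ μ ν, μ ≠ ν → hermOf η (b μ) (b ν) = 0) (hpos : ∀ ν, 0 < frameDiag η b ν)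
    (hspan : ∀ w, w ∈ Submodule.span ℂ (Set.range b)) {f : E → ℂ}
    (hf : f ∈ smoothTheta Φ (canonicalFactor Φ η χ))
    (h : ∀ θ ∈ thetaFunctions Φ (canonicalFactor Φ η χ), ∀ β : Fin g → ℕ, ahInner Φ η f (fockOp η b β θ) = 0) :
    f = 0 := by
  classical
  refine hη.eq_zero_of_forall_ahInner_iterate_deltaBar_eq_zero hχ hf fun θ hθ y N ↦ ?_
  obtain ⟨κ, hκ, hrepr⟩ := exists_iterate_deltaBar_eq_fockSum hη.isNSForm hχ hb hpos hspan hθ y N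
  rw [hrepr, fockSum]
  have hmem : ∀ α ∈ degLE g N, fockOp η b α (κ α) ∈ smoothTheta Φ (canonicalFactor Φ η χ) := fun α _ ↦
    fockOp_mem_smoothTheta_of_mem_thetaFunctions hη.isNSForm (hκ α) α
  have h1 := ahInner_sum_smul_right hη.isNSForm hχ (degLE g N) (c := fun _ ↦ (1 : ℂ)) hf hmem
  simp only [one_smul, map_one, one_mul] at h1
  rw [h1]
  exact Finset.sum_eq_zero fun α _ ↦ h (κ α) (hκ α) α

end Uniqueness

/-! ## §9 Tools for the analysis half: linearity of `δ̄^α` over finite sums, and `Σ_α (|α|+1)^{-2g} < ∞` -/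

section Tools

variable {ι : Type*} [Fintype ι] {E : Type*} [NormedAddCommGroup E] [NormedSpace ℂ E]
  {η : E [⋀^Fin 2]→L[ℝ] ℝ} {g : ℕ} {b : Fin g → E}

omit [Fintype ι] in
/-- **`δ̄^α (Σ_i c_i u_i) = Σ_i c_i δ̄^α u_i`** on `C^∞` functions. [cite: Folland1989, §1.7 (1.81)] -/
theorem fockOp_finset_sum_smul (h11 : ∀ u v : E, η ![I • u, I • v] = η ![u, v]) {σ : Type*} (s : Finset σ)
    (c : σ → ℂ) {u : σ → E → ℂ} (hu : ∀ i, ContDiff ℝ ∞ (u i)) (α : Fin g → ℕ) :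
    fockOp η b α (∑ i ∈ s, c i • u i) = ∑ i ∈ s, c i • fockOp η b α (u i) := by
  classical
  induction s using Finset.induction_on with
  | empty => simp [fockOp_zero_fun h11]
  | insert a s ha ih =>
    have hrest : ContDiff ℝ ∞ (∑ i ∈ s, c i • u i) := by
      rw [Finset.sum_fn]
      exact ContDiff.sum fun i _ ↦ (hu i).const_smul (c i)
    have ha' : ContDiff ℝ ∞ (c a • u a) := (hu a).const_smul (c a)
    rw [Finset.sum_insert ha, Finset.sum_insert ha, fockOp_add_fun h11 b α ha' hrest,
      fockOp_const_smul h11 (c a) b α (hu a), ih]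

/-- **`Σ_{α ∈ ℕ^g} (|α| + 1)^{-2g} < ∞`** (compare with `Σ_{k ∈ ℤ^g} (1 + |k|²)^{-g} < ∞` of the torus Fourier files
along `ℕ^g ↪ ℤ^g`, using `1 + Σ α_i² ≤ (Σ α_i + 1)²`). [folklore] -/
private theorem summable_inv_deg_add_one_pow (g : ℕ) :
    Summable fun α : Fin g → ℕ ↦ (((((∑ i, α i : ℕ) : ℝ) + 1) ^ (2 * g))⁻¹) := by
  set ι' : (Fin g → ℕ) → (Fin g → ℤ) := fun α i ↦ (α i : ℤ) with hι'
  have hinj : Function.Injective ι' := by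
    intro α β h
    funext i
    have := congr_fun h i
    simpa [hι'] using this
  have hG := (Torus.summable_inv_one_add_freqNormSq_pow_card (d := Fin g)).comp_injective hinj
  refine hG.of_nonneg_of_le (fun α ↦ by positivity) fun α ↦ ?_
  have hA : (0 : ℝ) ≤ ((∑ i, α i : ℕ) : ℝ) := Nat.cast_nonneg _
  have hF0 : 0 ≤ Torus.freqNormSq (ι' α) := Torus.freqNormSq_nonneg _
  rw [Function.comp_apply, Fintype.card_fin]
  refine inv_anti₀ (pow_pos (by linarith) _) ?_
  -- `(1 + Σ α_i²)^g ≤ (Σ α_i + 1)^{2g}`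
  rw [pow_mul]
  refine pow_le_pow_left₀ (by linarith) ?_ _
  have hsq : Torus.freqNormSq (ι' α) ≤ (((∑ i, α i : ℕ) : ℝ)) ^ 2 := by
    rw [Torus.freqNormSq]
    simp only [hι', Int.cast_natCast]
    push_cast
    rw [sq, Finset.sum_mul_sum]
    refine Finset.sum_le_sum fun i _ ↦ ?_
    rw [sq]
    refine (Finset.single_le_sum (f := fun j ↦ (α i : ℝ) * (α j : ℝ)) (fun j _ ↦ by positivity)
      (Finset.mem_univ i))
  nlinarith

end Tools

/-! ## §10 An `L²_h`-orthonormal basis of `H⁰(L(H, χ))` and the Fock data of a smooth section -/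

section Basis

variable {ι : Type*} [Fintype ι] {E : Type*} [NormedAddCommGroup E] [NormedSpace ℂ E] [FiniteDimensional ℂ E]
  {Φ : (ι → ℝ) ≃L[ℝ] E} {η : E [⋀^Fin 2]→L[ℝ] ℝ} {χ : (ι → ℤ) → ℂ}

/-- **An `L²_h`-orthonormal basis of `H⁰(L(H, χ))`**: there are `θ_1, …, θ_n ∈ H⁰(L(H, χ))` (`n = h⁰(L)`) with
`(θ_i, θ_j) = δ_{ij}` and `f = Σ_i (f, θ_i) θ_i` for every `f ∈ H⁰(L(H, χ))` (Gram–Schmidt for the positive definite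
Hermitian form `( , )` on the finite-dimensional space `H⁰(L)`). [cite: Lange2023AbelianVarietiesComplex, §1.6.1 (1.25)] -/
theorem exists_ahInner_orthonormalBasis (hη : IsNSForm Φ η) (hχ : IsSemicharacter Φ η χ) :
    ∃ (n : ℕ) (θ : Fin n → E → ℂ), (∀ i, θ i ∈ thetaFunctions Φ (canonicalFactor Φ η χ)) ∧
      (∀ i j, ahInner Φ η (θ i) (θ j) = if i = j then 1 else 0) ∧
      ∀ f ∈ thetaFunctions Φ (canonicalFactor Φ η χ), f = ∑ i, ahInner Φ η f (θ i) • θ i := by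
  classical
  set K := thetaFunctions Φ (canonicalFactor Φ η χ) with hK
  haveI : FiniteDimensional ℂ K := finiteDimensional_thetaFunctions (isFactor_canonicalFactor Φ hη hχ)
  have hKA : ∀ f : K, (f : E → ℂ) ∈ smoothTheta Φ (canonicalFactor Φ η χ) := fun f ↦ thetaFunctions_le_smoothTheta _ f.2
  let core : InnerProductSpace.Core ℂ K :=
    { inner := fun f g ↦ ahInner Φ η (g : E → ℂ) (f : E → ℂ)
      conj_inner_symm := fun f g ↦ (ahInner_conj_symm Φ η (f : E → ℂ) (g : E → ℂ)).symm
      re_inner_nonneg := fun f ↦ by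
        rw [RCLike.re_to_complex]
        exact (ahInner_self_nonneg Φ η (f : E → ℂ)).1
      add_left := fun f g h ↦ by
        simp only [Submodule.coe_add]
        exact ahInner_add_right hη hχ (hKA h) (hKA f) (hKA g)
      smul_left := fun f g r ↦ by
        simp only [Submodule.coe_smul]
        exact ahInner_const_mul_right Φ η r _ _
      definite := fun f hf ↦ Subtype.ext ((ahInner_self_eq_zero_iff hη hχ (hKA f)).1 hf) }
  letI : NormedAddCommGroup K := @InnerProductSpace.Core.toNormedAddCommGroup ℂ K _ _ _ core
  letI : InnerProductSpace ℂ K := InnerProductSpace.ofCore core.toCore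
  have hinner : ∀ f g : K, @inner ℂ K _ f g = ahInner Φ η (g : E → ℂ) (f : E → ℂ) := fun f g ↦ rfl
  let B := stdOrthonormalBasis ℂ K
  refine ⟨Module.finrank ℂ K, fun i ↦ (B i : E → ℂ), fun i ↦ (B i).2, fun i j ↦ ?_, fun f hf ↦ ?_⟩
  · have h := orthonormal_iff_ite.1 B.orthonormal j i
    rw [hinner] at h
    rw [h]
    by_cases hij : i = j
    · subst hij; simp
    · rw [if_neg hij, if_neg (Ne.symm hij)]
  · have h := B.sum_repr' ⟨f, hf⟩
    have h2 := congrArg Subtype.val h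
    rw [AddSubmonoidClass.coe_finsetSum] at h2
    simp only [Submodule.coe_smul, hinner] at h2
    exact h2.symm

end Basis

/-! ## §11 The Fock data of a smooth section and the expansion theorem `φ = Σ_α δ̄^α κ_α(φ)` -/

section Expansion

variable {ι : Type*} [Fintype ι] {E : Type*} [NormedAddCommGroup E] [NormedSpace ℂ E] [FiniteDimensional ℂ E]
  {Φ : (ι → ℝ) ≃L[ℝ] E} {η : E [⋀^Fin 2]→L[ℝ] ℝ} {χ : (ι → ℤ) → ℂ} {g : ℕ} {b : Fin g → E}

omit [Fintype ι] [FiniteDimensional ℂ E] in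
/-- A positive lower bound for the `π h_ν`. [cite: Lange2023AbelianVarietiesComplex, §1.6.1 p0063] -/
private theorem exists_pos_le_pi_mul_frameDiag (hpos : ∀ ν, 0 < frameDiag η b ν) :
    ∃ c : ℝ, 0 < c ∧ ∀ ν : Fin g, c ≤ ((fun _ ↦ (1 : ℝ)) ν)⁻¹ * (π * frameDiag η b ν) := by
  classical
  rcases isEmpty_or_nonempty (Fin g) with hg | hg
  · exact ⟨1, one_pos, fun ν ↦ (IsEmpty.false ν).elim⟩
  · obtain ⟨ν₀, -, hν₀⟩ := Finset.exists_min_image Finset.univ (fun ν ↦ π * frameDiag η b ν) Finset.univ_nonempty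
    refine ⟨π * frameDiag η b ν₀, mul_pos Real.pi_pos (hpos ν₀), fun ν ↦ ?_⟩
    rw [inv_one, one_mul]
    exact hν₀ ν (Finset.mem_univ ν)

/-- **Decay of the Fock coefficients of a smooth section along one holomorphic theta function**:
`Σ_α (|α|+1)^k |(φ, δ̄^α θ)|/‖δ̄^α θ‖ < ∞` for `φ ∈ A^{0,0}(L(H,χ))`, `θ ∈ H⁰(L(H,χ))` with `‖θ‖ = 1` — from the
Stage-1 bound `Σ_{α∈S} (1+|α|)^{2n} |(φ, δ̄^αθ)|²/‖δ̄^αθ‖² ≤ C_n` (`sum_fockCoeff_pow_le`, the eigenvalue trick with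
`(1 + Δ_∅)^n`), `2ab ≤ a² + b²` and `Σ_α (|α|+1)^{-2g} < ∞`. [cite: Folland1989, §1.7 (vii)] -/
theorem summable_pow_mul_norm_ahInner_fockOp_div (hη : IsNSForm Φ η) (hχ : IsSemicharacter Φ η χ)
    (hb : ∀ μ ν, μ ≠ ν → hermOf η (b μ) (b ν) = 0) (hpos : ∀ ν, 0 < frameDiag η b ν) {θ : E → ℂ}
    (hθ : θ ∈ thetaFunctions Φ (canonicalFactor Φ η χ)) (hθ1 : ahInner Φ η θ θ = 1) {φ : E → ℂ}
    (hφ : φ ∈ smoothTheta Φ (canonicalFactor Φ η χ)) (k : ℕ) :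
    Summable fun α : Fin g → ℕ ↦ ((((∑ i, α i : ℕ) : ℝ) + 1) ^ k *
      (‖ahInner Φ η φ (fockOp η b α θ)‖ / Real.sqrt (fockNormSq η b α))) := by
  classical
  obtain ⟨c, hc0, hc⟩ := exists_pos_le_pi_mul_frameDiag hpos
  have hθA := thetaFunctions_le_smoothTheta _ hθ
  have hhol : ∀ ν x, dbarAlong (b ν) θ x = 0 := fun ν x ↦ dbarAlong_eq_zero_of_mem_thetaFunctions hθ (b ν) x
  -- the square-summable majorant from Stage 1
  set n : ℕ := k + g with hn
  set C : ℝ := (max 1 c⁻¹) ^ (2 * n) *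
    (ahInner Φ η (onePlusLaplaceIter η b (fun _ ↦ (1 : ℝ)) n φ) (onePlusLaplaceIter η b (fun _ ↦ (1 : ℝ)) n φ)).re
  set F : (Fin g → ℕ) → ℝ := fun α ↦ (1 + ∑ ν, (α ν : ℝ)) ^ (2 * n) *
    (‖ahInner Φ η φ (fockOp η b α θ)‖ ^ 2 / (ahInner Φ η (fockOp η b α θ) (fockOp η b α θ)).re) with hF
  have hFnn : ∀ α, 0 ≤ F α := fun α ↦ mul_nonneg (by positivity)
    (div_nonneg (sq_nonneg _) (ahInner_self_nonneg Φ η _).1)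
  have hFsum : Summable F :=
    summable_of_sum_le hFnn fun S ↦ sum_fockCoeff_pow_le hη hχ hb hθA hhol hφ hc0 hc n S
  have hG := summable_inv_deg_add_one_pow g
  refine ((hFsum.add hG).mul_left (1 / 2 : ℝ)).of_nonneg_of_le (fun α ↦ by positivity) fun α ↦ ?_
  -- `(|α|+1)^k a ≤ ½ (F α + (|α|+1)^{-2g})` with `F α = (|α|+1)^{2n} a²`
  have hN := fockNormSq_pos η b hpos α
  have hnorm : (ahInner Φ η (fockOp η b α θ) (fockOp η b α θ)).re = fockNormSq η b α := by
    rw [re_ahInner_fockOp_self hη hχ hb hθA hhol α, hθ1, Complex.one_re, mul_one]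
  set A : ℝ := ((∑ i, α i : ℕ) : ℝ) + 1 with hA
  have hA1 : 1 ≤ A := by rw [hA]; have : (0:ℝ) ≤ (∑ i, α i : ℕ) := Nat.cast_nonneg _; linarith
  set a : ℝ := ‖ahInner Φ η φ (fockOp η b α θ)‖ / Real.sqrt (fockNormSq η b α) with ha
  have hFa : F α = A ^ (2 * n) * a ^ 2 := by
    rw [hF]
    dsimp only
    rw [hnorm, ha, div_pow, Real.sq_sqrt hN.le, hA]
    push_cast
    ring
  have hAk : A ^ k * a = (A ^ n * a) * (A ^ g)⁻¹ := by
    rw [hn, pow_add]; field_simp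
  rw [hAk, hFa, show A ^ (2 * n) * a ^ 2 = (A ^ n * a) ^ 2 by ring,
    show (A ^ (2 * g))⁻¹ = ((A ^ g)⁻¹) ^ 2 by rw [inv_pow, ← pow_mul, mul_comm g 2]]
  nlinarith [sq_nonneg (A ^ n * a - (A ^ g)⁻¹)]

/-- **The Fock expansion of a smooth section (existence).** For a Riemann form `H`, an `H`-orthogonal `ℂ`-basis
`e` with `h_ν > 0` and every `φ ∈ A^{0,0}(L(H, χ))` there is rapidly decreasing `H⁰(L(H, χ))`-valued Fock data `κ`
with `φ = Σ_α δ̄^α κ_α`; explicitly `κ_α = Σ_i ((φ, δ̄^α θ_i)/N(α)) θ_i` for an `L²_h`-orthonormal basis `(θ_i)` of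
`H⁰(L(H, χ))` (decay from Stage 1, synthesis from Stage 3b, identification of `φ` with its series by Stage 2).
[cite: Folland1989, §1.7 (vii)] -/
theorem IsRiemannForm.exists_isFockData_fockSeries_eq (hη : IsRiemannForm Φ η) (hχ : IsSemicharacter Φ η χ)
    (bB : Module.Basis (Fin g) ℂ E) (hb : ∀ μ ν, μ ≠ ν → hermOf η (bB μ) (bB ν) = 0)
    (hpos : ∀ ν, 0 < frameDiag η bB ν) {φ : E → ℂ} (hφ : φ ∈ smoothTheta Φ (canonicalFactor Φ η χ)) :
    ∃ κ : (Fin g → ℕ) → E → ℂ, IsFockData Φ η χ bB κ ∧ fockSeries η bB κ = φ := by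
  classical
  have hη' := hη.isNSForm
  have h11 := hη'.type_one_one
  have hspan : ∀ w, w ∈ Submodule.span ℂ (Set.range bB) := fun w ↦ bB.mem_span w
  obtain ⟨n, θ, hθ, horth, hexp⟩ := exists_ahInner_orthonormalBasis hη' hχ
  have hθA : ∀ i, θ i ∈ smoothTheta Φ (canonicalFactor Φ η χ) := fun i ↦ thetaFunctions_le_smoothTheta _ (hθ i)
  have hθ1 : ∀ i, ahInner Φ η (θ i) (θ i) = 1 := fun i ↦ by rw [horth, if_pos rfl]
  have hθn : ∀ i, ahNorm Φ η (θ i) = 1 := fun i ↦ by rw [ahNorm_def, hθ1, Complex.one_re, Real.sqrt_one]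
  -- the data
  set κ : (Fin g → ℕ) → E → ℂ := fun α ↦
    ∑ i, (ahInner Φ η φ (fockOp η bB α (θ i)) / (fockNormSq η bB α : ℂ)) • θ i with hκ_def
  have hκmem : ∀ α, κ α ∈ thetaFunctions Φ (canonicalFactor Φ η χ) := fun α ↦
    Submodule.sum_mem _ fun i _ ↦ Submodule.smul_mem _ _ (hθ i)
  have hκ : IsFockData Φ η χ bB κ := by
    refine ⟨hκmem, fun k ↦ ?_⟩
    have hmaj : ∀ α, fockWt Φ η bB k κ α ≤ ∑ i, (((∑ j, α j : ℕ) : ℝ) + 1) ^ k *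
        (‖ahInner Φ η φ (fockOp η bB α (θ i))‖ / Real.sqrt (fockNormSq η bB α)) := by
      intro α
      have hN := fockNormSq_pos η bB hpos α
      have hsN := Real.sqrt_pos.2 hN
      rw [fockWt_apply, ← Finset.mul_sum]
      refine mul_le_mul_of_nonneg_left ?_ (by positivity)
      calc Real.sqrt (fockNormSq η bB α) * ahNorm Φ η (κ α)
          ≤ Real.sqrt (fockNormSq η bB α) *
              ∑ i, ahNorm Φ η ((ahInner Φ η φ (fockOp η bB α (θ i)) / (fockNormSq η bB α : ℂ)) • θ i) :=
            mul_le_mul_of_nonneg_left (ahNorm_sum_le hη' hχ _ fun i _ ↦ Submodule.smul_mem _ _ (hθA i)) hsN.le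
        _ = ∑ i, ‖ahInner Φ η φ (fockOp η bB α (θ i))‖ / Real.sqrt (fockNormSq η bB α) := by
            rw [Finset.mul_sum]
            refine Finset.sum_congr rfl fun i _ ↦ ?_
            rw [ahNorm_smul, hθn, mul_one, norm_div, Complex.norm_real, Real.norm_eq_abs, abs_of_pos hN]
            set sN := Real.sqrt (fockNormSq η bB α) with hsN_def
            have hNs : fockNormSq η bB α = sN ^ 2 := by rw [hsN_def, Real.sq_sqrt hN.le]
            rw [hNs]
            field_simp
    exact (summable_sum fun i _ ↦ summable_pow_mul_norm_ahInner_fockOp_div hη' hχ hb hpos (hθ i) (hθ1 i) hφ k).of_nonneg_of_le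
      (fun α ↦ fockWt_nonneg k _ α) hmaj
  refine ⟨κ, hκ, ?_⟩
  -- `φ − Σ_α δ̄^α κ_α` has vanishing Fock coefficients
  have hS : fockSeries η bB κ ∈ smoothTheta Φ (canonicalFactor Φ η χ) := hκ.fockSeries_mem_smoothTheta hη' hχ hb hpos
  have hψ : φ - fockSeries η bB κ ∈ smoothTheta Φ (canonicalFactor Φ η χ) := sub_mem hφ hS
  have hzero := hη.eq_zero_of_forall_ahInner_fockOp_eq_zero hχ hb hpos hspan hψ fun θ' hθ' β ↦ by
    have hN : (fockNormSq η bB β : ℂ) ≠ 0 := by exact_mod_cast (fockNormSq_pos η bB hpos β).ne'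
    have hψβ := fockOp_mem_smoothTheta_of_mem_thetaFunctions (b := ⇑bB) hη' hθ' β
    rw [ahInner_sub_left hη' hχ hφ hS hψβ, hκ.ahInner_fockSeries_fockOp hη' hχ hb hpos hθ' β, sub_eq_zero]
    -- expand `θ'` in the orthonormal basis on the left, and `κ_β` on the right
    have hθ'A := thetaFunctions_le_smoothTheta _ hθ'
    rw [hκ_def]
    dsimp only
    rw [ahInner_sum_smul_left hη' hχ _ (fun i _ ↦ hθA i) hθ'A, Finset.mul_sum]
    conv_lhs => rw [hexp θ' hθ', fockOp_finset_sum_smul h11 _ _ (fun i ↦ (hθA i).1) β,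
      ahInner_sum_smul_right hη' hχ _ hφ (fun i _ ↦ fockOp_mem_smoothTheta_of_mem_thetaFunctions hη' (hθ i) β)]
    refine Finset.sum_congr rfl fun i _ ↦ ?_
    rw [← ahInner_conj_symm]
    field_simp
  exact (sub_eq_zero.1 hzero).symm

end Expansion

/-! # Part C — Dolbeault vanishing for positive `L` and Theorem 1.6.1 -/

/-! ## §12 Scaled Fock data; `δ̄_ν ∂̄_ν` and `Δ_I` on Fock series -/

section Diagonal

variable {ι : Type*} [Fintype ι] {E : Type*} [NormedAddCommGroup E] [NormedSpace ℂ E] [FiniteDimensional ℂ E]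
  {Φ : (ι → ℝ) ≃L[ℝ] E} {η : E [⋀^Fin 2]→L[ℝ] ℝ} {χ : (ι → ℤ) → ℂ} {g : ℕ} {bB : Module.Basis (Fin g) ℂ E}

omit [FiniteDimensional ℂ E] in
/-- **Polynomially bounded scalars preserve Fock data**: if `|c_α| ≤ C (|α|+1)^m` then `(c_α κ_α)_α` is Fock data.
[cite: Folland1989, §1.7 (vii)] -/
theorem IsFockData.smul_fun {b : Fin g → E} {κ : (Fin g → ℕ) → E → ℂ} (hκ : IsFockData Φ η χ b κ)
    {c : (Fin g → ℕ) → ℂ} {C : ℝ} {m : ℕ} (hc : ∀ α, ‖c α‖ ≤ C * ((((∑ i, α i : ℕ) : ℝ)) + 1) ^ m) :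
    IsFockData Φ η χ b (fun α ↦ c α • κ α) := by
  refine ⟨fun α ↦ Submodule.smul_mem _ _ (hκ.mem α), fun k ↦ ?_⟩
  have hC : 0 ≤ C := by
    have h := hc 0
    have h0 : (0 : ℝ) ≤ ‖c 0‖ := norm_nonneg _
    have h1 : (0 : ℝ) < ((((∑ i, (0 : Fin g → ℕ) i : ℕ) : ℝ)) + 1) ^ m := by positivity
    nlinarith
  refine ((hκ.rapid (k + m)).mul_left C).of_nonneg_of_le (fun α ↦ fockWt_nonneg k _ α) fun α ↦ ?_
  rw [fockWt_apply, fockWt_apply, ahNorm_smul, pow_add]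
  have h0 : 0 ≤ Real.sqrt (fockNormSq η b α) * ahNorm Φ η (κ α) := mul_nonneg (Real.sqrt_nonneg _) (ahNorm_nonneg Φ η _)
  calc ((((∑ i, α i : ℕ) : ℝ)) + 1) ^ k * (Real.sqrt (fockNormSq η b α) * (‖c α‖ * ahNorm Φ η (κ α)))
      = ‖c α‖ * (((((∑ i, α i : ℕ) : ℝ)) + 1) ^ k * (Real.sqrt (fockNormSq η b α) * ahNorm Φ η (κ α))) := by ring
    _ ≤ (C * ((((∑ i, α i : ℕ) : ℝ)) + 1) ^ m) *
        (((((∑ i, α i : ℕ) : ℝ)) + 1) ^ k * (Real.sqrt (fockNormSq η b α) * ahNorm Φ η (κ α))) :=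
        mul_le_mul_of_nonneg_right (hc α) (by positivity)
    _ = C * (((((∑ i, α i : ℕ) : ℝ)) + 1) ^ k * ((((∑ i, α i : ℕ) : ℝ)) + 1) ^ m *
        (Real.sqrt (fockNormSq η b α) * ahNorm Φ η (κ α))) := by ring

omit [Fintype ι] [FiniteDimensional ℂ E] in
/-- The number-operator weights `π h_ν α_ν` are polynomially bounded. [cite: Folland1989, §1.7 (1.82)] -/
theorem norm_numberWeight_le {b : Fin g → E} (hpos : ∀ ν, 0 < frameDiag η b ν) (ν : Fin g) (α : Fin g → ℕ) :
    ‖(((π * frameDiag η b ν * α ν : ℝ)) : ℂ)‖ ≤ (π * frameDiag η b ν) * ((((∑ i, α i : ℕ) : ℝ)) + 1) ^ 1 := by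
  have hh : 0 < π * frameDiag η b ν := mul_pos Real.pi_pos (hpos ν)
  rw [Complex.norm_real, Real.norm_eq_abs, abs_of_nonneg (by positivity), pow_one]
  refine mul_le_mul_of_nonneg_left ?_ hh.le
  have h1 : (α ν : ℝ) ≤ (∑ i, α i : ℕ) := by
    exact_mod_cast Finset.single_le_sum (f := α) (fun j _ ↦ Nat.zero_le _) (Finset.mem_univ ν)
  linarith

/-- **`δ̄_{e_ν} ∂̄_{e_ν} (Σ_α δ̄^α κ_α) = Σ_α (π h_ν α_ν) δ̄^α κ_α`** — the number operator in direction `ν` is diagonal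
on Fock data. [cite: Lange2023AbelianVarietiesComplex, §1.6.1 Prop. 1.6.3] -/
theorem IsFockData.deltaBar_dbarAlong_basis_fockSeries (hη : IsNSForm Φ η) (hχ : IsSemicharacter Φ η χ)
    (hb : ∀ μ ν, μ ≠ ν → hermOf η (bB μ) (bB ν) = 0) (hpos : ∀ ν, 0 < frameDiag η bB ν)
    {κ : (Fin g → ℕ) → E → ℂ} (hκ : IsFockData Φ η χ bB κ) (ν : Fin g) :
    deltaBar η (bB ν) (dbarAlong (bB ν) (fockSeries η bB κ)) =
      fockSeries η bB (fun α ↦ (((π * frameDiag η bB ν * α ν : ℝ)) : ℂ) • κ α) := by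
  rw [hκ.dbarAlong_basis_fockSeries hη hχ hb hpos ν, (hκ.annData hpos ν).deltaBar_basis_fockSeries hη hχ hb hpos ν]
  congr 1
  funext α
  by_cases h : α ν = 0
  · rw [show ComplexTorus.creShift ν (ComplexTorus.annData η bB ν κ) α = 0 from if_pos h, h]
    push_cast
    simp
  · rw [show ComplexTorus.creShift ν (ComplexTorus.annData η bB ν κ) α =
        ComplexTorus.annData η bB ν κ (α - Pi.single ν 1) from if_neg h, annData_apply]
    have h1 : α - Pi.single ν 1 + Pi.single ν 1 = α := by
      funext j
      simp only [Pi.add_apply, Pi.sub_apply]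
      by_cases hj : j = ν
      · subst hj; rw [Pi.single_eq_same]; omega
      · rw [Pi.single_eq_of_ne hj]; omega
    have h2 : (((α - Pi.single ν 1 : Fin g → ℕ) ν : ℕ) : ℝ) + 1 = α ν := by
      have h3 : (α - Pi.single ν 1 : Fin g → ℕ) ν + 1 = α ν := by
        simp only [Pi.sub_apply, Pi.single_eq_same]; omega
      exact_mod_cast h3
    rw [h1, h2]

/-- **`Δ_I (Σ_α δ̄^α κ_α) = Σ_α λ_I(α) δ̄^α κ_α`**, `λ_I(α) = Σ_ν k_ν^{-1} π h_ν α_ν + π Σ_{i∈I} k_i^{-1} h_i` — the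
`∂̄`-Laplacian of Prop. 1.6.3 is diagonal on Fock data. [cite: Lange2023AbelianVarietiesComplex, §1.6.1 Prop. 1.6.3] -/
theorem IsFockData.laplaceI_fockSeries (hη : IsNSForm Φ η) (hχ : IsSemicharacter Φ η χ)
    (hb : ∀ μ ν, μ ≠ ν → hermOf η (bB μ) (bB ν) = 0) (hpos : ∀ ν, 0 < frameDiag η bB ν)
    {κ : (Fin g → ℕ) → E → ℂ} (hκ : IsFockData Φ η χ bB κ) (k : Fin g → ℝ) (I : Finset (Fin g)) :
    laplaceI η bB k I (fockSeries η bB κ) = fockSeries η bB (fun α ↦ ((fockEigenvalue η bB k I α : ℝ) : ℂ) • κ α) := by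
  have hspan : ∀ w, w ∈ Submodule.span ℂ (Set.range bB) := fun w ↦ bB.mem_span w
  -- the data on the right as a combination of the number-operator data and `κ`
  have hd : ∀ ν, IsFockData Φ η χ bB (fun α ↦ (((π * frameDiag η bB ν * α ν : ℝ)) : ℂ) • κ α) := fun ν ↦
    hκ.smul_fun (norm_numberWeight_le hpos ν)
  set cI : ℂ := ((π * ∑ ν ∈ I, (k ν)⁻¹ * frameDiag η bB ν : ℝ) : ℂ) with hcI
  have hdata : (fun α ↦ ((fockEigenvalue η bB k I α : ℝ) : ℂ) • κ α) =
      ∑ ν, (((k ν)⁻¹ : ℝ) : ℂ) • (fun α ↦ (((π * frameDiag η bB ν * α ν : ℝ)) : ℂ) • κ α) + cI • κ := by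
    funext α
    simp only [Pi.add_apply, Finset.sum_apply, Pi.smul_apply, smul_smul, ← Finset.sum_smul, ← add_smul]
    congr 1
    rw [fockEigenvalue_apply, hcI]
    push_cast
    ring
  rw [hdata, IsFockData.fockSeries_add hη hχ hb hpos hspan (IsFockData.finset_sum_smul hη hχ _ _ hd) (hκ.smul cI),
    IsFockData.fockSeries_finset_sum_smul hη hχ hb hpos hspan _ _ hd, fockSeries_smul hη.type_one_one cI hκ.contDiff]
  funext x
  rw [laplaceI_apply, Pi.add_apply, Finset.sum_apply, Pi.smul_apply, smul_eq_mul]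
  congr 1
  · refine Finset.sum_congr rfl fun ν _ ↦ ?_
    rw [hκ.deltaBar_dbarAlong_basis_fockSeries hη hχ hb hpos ν, Pi.smul_apply, smul_eq_mul]
  · rw [hcI]
    simp only [hermOf_frame_self]
    push_cast
    rw [Finset.mul_sum]

end Diagonal

/-! ## §13 The Green data `κ/λ_I` and the commutation `∂̄ G = G ∂̄` on Fock data -/

section Green

variable {ι : Type*} [Fintype ι] {E : Type*} [NormedAddCommGroup E] [NormedSpace ℂ E] [FiniteDimensional ℂ E]
  {Φ : (ι → ℝ) ≃L[ℝ] E} {η : E [⋀^Fin 2]→L[ℝ] ℝ} {χ : (ι → ℤ) → ℂ} {g : ℕ} {b : Fin g → E} {k : Fin g → ℝ}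

omit [Fintype ι] [FiniteDimensional ℂ E] in
/-- `λ_I(α) ≥ 0` for positive `h_ν`, `k_ν`. [cite: Lange2023AbelianVarietiesComplex, §1.6.2 Lemma 1.6.6] -/
theorem fockEigenvalue_nonneg (hpos : ∀ ν, 0 < frameDiag η b ν) (hk : ∀ ν, 0 < k ν) (I : Finset (Fin g))
    (α : Fin g → ℕ) : 0 ≤ fockEigenvalue η b k I α := by
  rw [fockEigenvalue_apply]
  have h1 : ∀ ν, 0 ≤ (k ν)⁻¹ * (π * frameDiag η b ν * α ν) := fun ν ↦
    mul_nonneg (inv_nonneg.2 (hk ν).le) (mul_nonneg (mul_pos Real.pi_pos (hpos ν)).le (Nat.cast_nonneg _))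
  have h2 : ∀ ν, 0 ≤ (k ν)⁻¹ * frameDiag η b ν := fun ν ↦ mul_nonneg (inv_nonneg.2 (hk ν).le) (hpos ν).le
  exact add_nonneg (Finset.sum_nonneg fun ν _ ↦ h1 ν) (mul_nonneg Real.pi_pos.le (Finset.sum_nonneg fun ν _ ↦ h2 ν))

omit [Fintype ι] [FiniteDimensional ℂ E] in
/-- **`λ_I(α) ≥ π k_i^{-1} h_i > 0` for `i ∈ I`** — the spectral gap of `Δ_I` on `(0,q)`-forms with `q ≥ 1`
(Lange's `(Δ ω, ω) ≥ π R_I (ω, ω)`). [cite: Lange2023AbelianVarietiesComplex, §1.6.2 Lemma 1.6.6] -/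
theorem exists_pos_le_fockEigenvalue (hpos : ∀ ν, 0 < frameDiag η b ν) (hk : ∀ ν, 0 < k ν) {I : Finset (Fin g)}
    (hI : I.Nonempty) : ∃ c : ℝ, 0 < c ∧ ∀ α : Fin g → ℕ, c ≤ fockEigenvalue η b k I α := by
  obtain ⟨i, hi⟩ := hI
  refine ⟨π * ((k i)⁻¹ * frameDiag η b i), mul_pos Real.pi_pos (mul_pos (inv_pos.2 (hk i)) (hpos i)), fun α ↦ ?_⟩
  rw [fockEigenvalue_apply]
  have h1 : ∀ ν, 0 ≤ (k ν)⁻¹ * (π * frameDiag η b ν * α ν) := fun ν ↦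
    mul_nonneg (inv_nonneg.2 (hk ν).le) (mul_nonneg (mul_pos Real.pi_pos (hpos ν)).le (Nat.cast_nonneg _))
  have h2 : ∀ ν, 0 ≤ (k ν)⁻¹ * frameDiag η b ν := fun ν ↦ mul_nonneg (inv_nonneg.2 (hk ν).le) (hpos ν).le
  have h3 : (k i)⁻¹ * frameDiag η b i ≤ ∑ ν ∈ I, (k ν)⁻¹ * frameDiag η b ν :=
    Finset.single_le_sum (f := fun ν ↦ (k ν)⁻¹ * frameDiag η b ν) (fun ν _ ↦ h2 ν) hi
  nlinarith [Finset.sum_nonneg fun ν (_ : ν ∈ Finset.univ) ↦ h1 ν, Real.pi_pos]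

omit [Fintype ι] [FiniteDimensional ℂ E] in
/-- **The key identity `λ_{J ∖ {ν}}(β + 1_ν) = λ_J(β)` for `ν ∈ J`** (one more quantum in direction `ν` costs
exactly what the index `ν ∈ J` contributes) — the reason `∂̄` commutes with `Δ^{-1}` on Fock data.
[cite: Lange2023AbelianVarietiesComplex, §1.6.1 Prop. 1.6.3] -/
theorem fockEigenvalue_erase_add_single {J : Finset (Fin g)} {ν : Fin g} (hν : ν ∈ J) (β : Fin g → ℕ) :
    fockEigenvalue η b k (J.erase ν) (β + Pi.single ν 1) = fockEigenvalue η b k J β := by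
  classical
  rw [fockEigenvalue_apply, fockEigenvalue_apply, ← Finset.add_sum_erase J _ hν]
  have h1 : ∀ μ, (k μ)⁻¹ * (π * frameDiag η b μ * ((β + Pi.single ν 1 : Fin g → ℕ) μ : ℕ)) =
      (k μ)⁻¹ * (π * frameDiag η b μ * (β μ : ℕ)) + (if μ = ν then (k ν)⁻¹ * (π * frameDiag η b ν) else 0) := by
    intro μ
    by_cases h : μ = ν
    · subst h; simp; ring
    · rw [if_neg h, Pi.add_apply, Pi.single_eq_of_ne h]; simp
  simp only [h1, Finset.sum_add_distrib, Finset.sum_ite_eq', Finset.mem_univ, if_true]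
  ring

variable (η b k) in
/-- **The Green data** `(G_I κ)_α = λ_I(α)^{-1} κ_α`. [cite: Lange2023AbelianVarietiesComplex, §1.6.1 Prop. 1.6.3] -/
def greenData (I : Finset (Fin g)) (κ : (Fin g → ℕ) → E → ℂ) : (Fin g → ℕ) → E → ℂ :=
  fun α ↦ (((fockEigenvalue η b k I α)⁻¹ : ℝ) : ℂ) • κ α

omit [Fintype ι] [FiniteDimensional ℂ E] in
/-- Unfolding of `greenData`. [cite: Lange2023AbelianVarietiesComplex, §1.6.1 Prop. 1.6.3] -/
theorem greenData_apply (I : Finset (Fin g)) (κ : (Fin g → ℕ) → E → ℂ) (α : Fin g → ℕ) :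
    greenData η b k I κ α = (((fockEigenvalue η b k I α)⁻¹ : ℝ) : ℂ) • κ α := rfl

omit [Fintype ι] [FiniteDimensional ℂ E] in
/-- The Green data of the zero data is zero. [cite: Lange2023AbelianVarietiesComplex, §1.6.1 Prop. 1.6.3] -/
@[simp] theorem greenData_zero (I : Finset (Fin g)) : greenData η b k I (0 : (Fin g → ℕ) → E → ℂ) = 0 := by
  funext α; simp [greenData_apply]

omit [FiniteDimensional ℂ E] in
/-- The Green data of Fock data is Fock data (for `I ≠ ∅`, where `λ_I ≥ c > 0`). [cite: Lange2023AbelianVarietiesComplex, §1.6.1 Prop. 1.6.3] -/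
theorem IsFockData.greenData (hpos : ∀ ν, 0 < frameDiag η b ν) (hk : ∀ ν, 0 < k ν) {I : Finset (Fin g)}
    (hI : I.Nonempty) {κ : (Fin g → ℕ) → E → ℂ} (hκ : IsFockData Φ η χ b κ) :
    IsFockData Φ η χ b (greenData η b k I κ) := by
  obtain ⟨c, hc, hcle⟩ := exists_pos_le_fockEigenvalue hpos hk hI
  refine hκ.smul_fun (C := c⁻¹) (m := 0) fun α ↦ ?_
  rw [pow_zero, mul_one, Complex.norm_real, Real.norm_eq_abs, abs_of_nonneg (inv_nonneg.2 (fockEigenvalue_nonneg hpos hk I α))]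
  exact inv_anti₀ hc (hcle α)

omit [Fintype ι] [FiniteDimensional ℂ E] in
/-- **`λ_I · G_I κ = κ`** for `I ≠ ∅`. [cite: Lange2023AbelianVarietiesComplex, §1.6.1 Prop. 1.6.3] -/
theorem fockEigenvalue_smul_greenData (hpos : ∀ ν, 0 < frameDiag η b ν) (hk : ∀ ν, 0 < k ν)
    {I : Finset (Fin g)} (hI : I.Nonempty) (κ : (Fin g → ℕ) → E → ℂ) :
    (fun α ↦ ((fockEigenvalue η b k I α : ℝ) : ℂ) • greenData η b k I κ α) = κ := by
  obtain ⟨c, hc, hcle⟩ := exists_pos_le_fockEigenvalue hpos hk hI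
  funext α
  have hne : (fockEigenvalue η b k I α : ℂ) ≠ 0 := by exact_mod_cast (lt_of_lt_of_le hc (hcle α)).ne'
  rw [greenData_apply, smul_smul, Complex.ofReal_inv, mul_inv_cancel₀ hne, one_smul]

omit [Fintype ι] [FiniteDimensional ℂ E] in
/-- **`A_ν (G_{J∖ν} κ) = G_J (A_ν κ)` for `ν ∈ J`** — the annihilation shift commutes with the Green data up to
the change of index set, by `λ_{J∖ν}(β + 1_ν) = λ_J(β)`. [cite: Lange2023AbelianVarietiesComplex, §1.6.1 Prop. 1.6.3] -/
theorem annData_greenData_erase {J : Finset (Fin g)} {ν : Fin g} (hν : ν ∈ J) (κ : (Fin g → ℕ) → E → ℂ) :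
    annData η b ν (greenData η b k (J.erase ν) κ) = greenData η b k J (annData η b ν κ) := by
  funext β
  rw [annData_apply, greenData_apply, greenData_apply, annData_apply, fockEigenvalue_erase_add_single hν,
    smul_smul, smul_smul, mul_comm]

end Green

/-! ## §14 Dolbeault vanishing: every `∂̄`-closed `L`-valued `(0,q)`-form, `q ≥ 1`, is `∂̄`-exact -/

section Vanishing

variable {ι : Type*} [Fintype ι] {E : Type*} [NormedAddCommGroup E] [NormedSpace ℂ E] [FiniteDimensional ℂ E]
  {Φ : (ι → ℝ) ≃L[ℝ] E} {η : E [⋀^Fin 2]→L[ℝ] ℝ} {χ : (ι → ℤ) → ℂ} {g : ℕ} {bB : Module.Basis (Fin g) ℂ E}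

omit [Fintype ι] [FiniteDimensional ℂ E] in
/-- The Fock series of the zero data vanishes. [cite: Folland1989, §1.7 (vii)] -/
theorem fockSeries_zero {b : Fin g → E} (h11 : ∀ u v : E, η ![I • u, I • v] = η ![u, v]) :
    fockSeries η b (0 : (Fin g → ℕ) → E → ℂ) = 0 := by
  funext v
  simp [fockSeries_apply, fockOp_zero_fun h11]

/-- **Fock data is determined by its series.** [cite: Folland1989, §1.7 (vii)] -/
theorem IsFockData.eq_of_fockSeries_eq (hη : IsNSForm Φ η) (hχ : IsSemicharacter Φ η χ)
    (hb : ∀ μ ν, μ ≠ ν → hermOf η (bB μ) (bB ν) = 0) (hpos : ∀ ν, 0 < frameDiag η bB ν)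
    {κ κ' : (Fin g → ℕ) → E → ℂ} (hκ : IsFockData Φ η χ bB κ) (hκ' : IsFockData Φ η χ bB κ')
    (heq : fockSeries η bB κ = fockSeries η bB κ') : κ = κ' := by
  funext β
  have h := hκ.ahInner_sub_self_eq_zero_of_fockSeries_eq hη hχ hb hpos hκ' heq β
  have hmem : κ β - κ' β ∈ smoothTheta Φ (canonicalFactor Φ η χ) :=
    thetaFunctions_le_smoothTheta _ (sub_mem (hκ.mem β) (hκ'.mem β))
  exact sub_eq_zero.1 ((ahInner_self_eq_zero_iff hη hχ hmem).1 h)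

/-- **Theorem (Dolbeault vanishing for a positive line bundle on a complex torus; Lange 2023, Thm. 1.6.4 with
`r = g`, in the `∂̄`-cohomology of Thm. 1.6.1).** Let `H` be a Riemann form (positive definite) on `X = V/Λ` with
semicharacter `χ`, `L = L(H, χ)`, `e` an `H`-orthogonal `ℂ`-basis of `V` with `h_ν > 0`, `k_ν > 0` Kähler weights,
and `q ≥ 1`. Then every `∂̄`-closed form `σ ∈ A^{0,q}(L)` is `∂̄`-exact: `σ = ∂̄(δ̄ G σ)` with the Green operator
`G = Δ^{-1}` realised on Fock data by `κ_α ↦ κ_α / λ_I(α)` (`Δ_I` is diagonal on Fock data with eigenvalues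
`λ_I(α) ≥ π min_{i ∈ I} h_i/k_i > 0`, and `∂̄ G = G ∂̄` because `λ_{J∖ν}(β + 1_ν) = λ_J(β)`). Hence
`H^{0,q}_{∂̄}(X, L) = 0` for `q ≥ 1` — the vanishing `H^q(X, L) = 0` (`q > g − r = 0`) of Theorem 1.6.4, obtained
here WITHOUT the Hodge theorem `H^q(L) ≃ ℋ^q(L)` (Thm. 1.6.1, which Lange quotes from Griffiths–Harris), by the
Fock expansion of `A^{0,0}(L)` (rows A2-88 … A2-91 and Parts A–B of this file).
[cite: Lange2023AbelianVarietiesComplex, §1.6.2 Thm. 1.6.4] [cite: Lange2023AbelianVarietiesComplex, §1.6.1 Thm. 1.6.1] -/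
theorem IsRiemannForm.mem_dbarExactForms_of_mem_dbarClosedForms (hη : IsRiemannForm Φ η)
    (hχ : IsSemicharacter Φ η χ) (bB : Module.Basis (Fin g) ℂ E) (hb : ∀ μ ν, μ ≠ ν → hermOf η (bB μ) (bB ν) = 0)
    (hpos : ∀ ν, 0 < frameDiag η bB ν) {k : Fin g → ℝ} (hk : ∀ ν, 0 < k ν) {q : ℕ} (hq : 1 ≤ q)
    {σ : Finset (Fin g) → E → ℂ} (hσ : σ ∈ dbarClosedForms Φ η χ bB q) : σ ∈ dbarExactForms Φ η χ bB q := by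
  classical
  have hσ' : σ ∈ formSpace Φ (canonicalFactor Φ η χ) g ∧ IsHomogeneous q σ ∧ dbarForm bB σ = 0 := hσ
  obtain ⟨hσA, hσq, hσ0⟩ := hσ'
  have hη' := hη.isNSForm
  have h11 := hη'.type_one_one
  have hspan : ∀ w, w ∈ Submodule.span ℂ (Set.range bB) := fun w ↦ bB.mem_span w
  have hσI : ∀ I, σ I ∈ smoothTheta Φ (canonicalFactor Φ η χ) := mem_formSpace_iff.1 hσA
  -- Fock data of the coefficients (zero data where the coefficient vanishes)
  have hex : ∀ I : Finset (Fin g), ∃ κ : (Fin g → ℕ) → E → ℂ, IsFockData Φ η χ bB κ ∧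
      fockSeries η bB κ = σ I ∧ (σ I = 0 → κ = 0) := by
    intro I
    by_cases h0 : σ I = 0
    · exact ⟨0, IsFockData.zero, by rw [h0]; exact fockSeries_zero h11, fun _ ↦ rfl⟩
    · obtain ⟨κ, hκ, hS⟩ := hη.exists_isFockData_fockSeries_eq hχ bB hb hpos (hσI I)
      exact ⟨κ, hκ, hS, fun h ↦ absurd h h0⟩
  choose κ hκ hκS hκ0 using hex
  have hσ_empty : ∀ I : Finset (Fin g), ¬ I.Nonempty → σ I = 0 := by
    intro I hI
    rw [Finset.not_nonempty_iff_eq_empty] at hI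
    exact hσq I (by rw [hI, Finset.card_empty]; omega)
  -- the Green form `τ = G σ`
  have hGdata : ∀ I, IsFockData Φ η χ bB (greenData η bB k I (κ I)) := by
    intro I
    by_cases hI : I.Nonempty
    · exact (hκ I).greenData hpos hk hI
    · rw [hκ0 I (hσ_empty I hI), greenData_zero]; exact IsFockData.zero
  set τ : Finset (Fin g) → E → ℂ := fun I ↦ fockSeries η bB (greenData η bB k I (κ I)) with hτ
  have hτA : τ ∈ formSpace Φ (canonicalFactor Φ η χ) g :=
    mem_formSpace_iff.2 fun I ↦ (hGdata I).fockSeries_mem_smoothTheta hη' hχ hb hpos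
  have hτsm : ∀ J, ContDiff ℝ ∞ (τ J) := fun J ↦ (mem_formSpace_iff.1 hτA J).1
  have hτq : IsHomogeneous q τ := by
    intro I hI
    show fockSeries η bB (greenData η bB k I (κ I)) = 0
    rw [hκ0 I (hσq I hI), greenData_zero, fockSeries_zero h11]
  -- (a) `Δ τ = σ`
  have hΔ : laplaceForm η bB k τ = σ := by
    funext I x
    rw [laplaceForm_apply h11 hb hτsm I x]
    show laplaceI η bB k I (fockSeries η bB (greenData η bB k I (κ I))) x = σ I x
    rw [(hGdata I).laplaceI_fockSeries hη' hχ hb hpos k I]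
    by_cases hI : I.Nonempty
    · rw [fockEigenvalue_smul_greenData hpos hk hI, hκS]
    · have h0 : σ I = 0 := hσ_empty I hI
      rw [hκ0 I h0, greenData_zero, h0]
      simp [fockSeries_apply, fockOp_zero_fun h11]
  -- (b) `∂̄ τ = 0`
  have hdbar : dbarForm bB τ = 0 := by
    funext J
    -- the Fock data `D` of `(∂̄σ)_J = 0`
    set D : (Fin g → ℕ) → E → ℂ :=
      ∑ ν ∈ J, koszulSign ν (J.erase ν) • annData η bB ν (κ (J.erase ν)) with hD
    have hDdata : IsFockData Φ η χ bB D :=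
      IsFockData.finset_sum_smul hη' hχ _ _ (fun ν ↦ (hκ (J.erase ν)).annData hpos ν)
    have hDS : fockSeries η bB D = dbarForm bB σ J := by
      funext y
      rw [hD, IsFockData.fockSeries_finset_sum_smul hη' hχ hb hpos hspan _ _ (fun ν ↦ (hκ (J.erase ν)).annData hpos ν),
        Finset.sum_apply, dbarForm_apply]
      refine Finset.sum_congr rfl fun ν _ ↦ ?_
      rw [Pi.smul_apply, smul_eq_mul, ← (hκ (J.erase ν)).dbarAlong_basis_fockSeries hη' hχ hb hpos ν, hκS]
    have hD0 : D = 0 := by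
      refine hDdata.eq_of_fockSeries_eq hη' hχ hb hpos IsFockData.zero ?_
      rw [hDS, fockSeries_zero h11, hσ0]
      rfl
    -- `(∂̄τ)_J = fockSeries (G_J D) = 0`
    have hGD : ∀ ν ∈ J, IsFockData Φ η χ bB (annData η bB ν (greenData η bB k (J.erase ν) (κ (J.erase ν)))) :=
      fun ν _ ↦ (hGdata (J.erase ν)).annData hpos ν
    have hτJ : dbarForm bB τ J = fockSeries η bB (greenData η bB k J D) := by
      have hsum : greenData η bB k J D =
          ∑ ν ∈ J, koszulSign ν (J.erase ν) • annData η bB ν (greenData η bB k (J.erase ν) (κ (J.erase ν))) := by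
        funext β
        rw [greenData_apply, hD, Finset.sum_apply, Finset.sum_apply, Finset.smul_sum]
        refine Finset.sum_congr rfl fun ν hν ↦ ?_
        rw [Pi.smul_apply, Pi.smul_apply, annData_greenData_erase hν, greenData_apply, smul_comm]
      funext y
      rw [hsum, IsFockData.fockSeries_finset_sum_smul hη' hχ hb hpos hspan _ _ ?_, Finset.sum_apply, dbarForm_apply]
      · refine Finset.sum_congr rfl fun ν _ ↦ ?_
        rw [Pi.smul_apply, smul_eq_mul, ← (hGdata (J.erase ν)).dbarAlong_basis_fockSeries hη' hχ hb hpos ν]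
      · exact fun ν ↦ (hGdata (J.erase ν)).annData hpos ν
    rw [hτJ, hD0, greenData_zero, fockSeries_zero h11]
    rfl
  -- (c) `σ = Δτ = ∂̄(δ̄τ)`
  have hexact : dbarForm bB (deltaForm η bB k τ) = σ := by
    have h := hΔ
    rw [show laplaceForm η bB k τ = fun I x ↦ dbarForm bB (deltaForm η bB k τ) I x + deltaForm η bB k (dbarForm bB τ) I x
      from rfl, hdbar, deltaForm_zero] at h
    funext I x
    have := congr_fun (congr_fun h I) x
    simpa using this
  have hq' : IsHomogeneous ((q - 1) + 1) τ := by rwa [Nat.sub_add_cancel hq]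
  show IsHomogeneous q σ ∧ ∃ τ', τ' ∈ formSpace Φ (canonicalFactor Φ η χ) g ∧ IsHomogeneous (q - 1) τ' ∧ dbarForm bB τ' = σ
  exact ⟨hσq, deltaForm η bB k τ, deltaForm_mem_formSpace (b := ⇑bB) (η := η) (k := k) hη' hτA,
    IsHomogeneous.deltaForm (b := ⇑bB) (η := η) (k := k) hq', hexact⟩

/-- **Corollary: `H^{0,q}_{∂̄}(X, L) = 0` for `q ≥ 1` and positive `L`** — the `∂̄`-closed and the `∂̄`-exact
`L`-valued `(0,q)`-forms coincide (as subspaces of the coefficient families).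
[cite: Lange2023AbelianVarietiesComplex, §1.6.2 Thm. 1.6.4] -/
theorem IsRiemannForm.dbarClosedForms_le_dbarExactForms (hη : IsRiemannForm Φ η)
    (hχ : IsSemicharacter Φ η χ) (bB : Module.Basis (Fin g) ℂ E) (hb : ∀ μ ν, μ ≠ ν → hermOf η (bB μ) (bB ν) = 0)
    (hpos : ∀ ν, 0 < frameDiag η bB ν) {q : ℕ} (hq : 1 ≤ q) :
    dbarClosedForms Φ η χ bB q ≤ dbarExactForms Φ η χ bB q := fun _ hσ ↦
  hη.mem_dbarExactForms_of_mem_dbarClosedForms hχ bB hb hpos (k := fun _ ↦ 1) (fun _ ↦ one_pos) hq hσ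

end Vanishing

/-! ## §15 `H^{0,q}_{∂̄}(X, L) = 0` (`q ≥ 1`) on the quotient, Theorem 1.6.1 for positive `L` in every degree,
and the table `h^q(L) = [q = 0] · h⁰(L)` -/

section HodgeIsomorphism

variable {ι : Type*} [Fintype ι] {E : Type*} [NormedAddCommGroup E] [NormedSpace ℂ E] [FiniteDimensional ℂ E]
  {Φ : (ι → ℝ) ≃L[ℝ] E} {η : E [⋀^Fin 2]→L[ℝ] ℝ} {χ : (ι → ℤ) → ℂ} {g : ℕ}

/-- **`H^{0,q}_{∂̄}(X, L(H, χ))` is trivial for `q ≥ 1` and `H` positive definite** (the quotient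
`Z^{0,q}_{∂̄}/B^{0,q}_{∂̄}` of row A2-79 has one element). [cite: Lange2023AbelianVarietiesComplex, §1.6.2 Thm. 1.6.4] -/
theorem IsRiemannForm.subsingleton_dbarCohomology (hη : IsRiemannForm Φ η) (hχ : IsSemicharacter Φ η χ)
    (bB : Module.Basis (Fin g) ℂ E) (hb : ∀ μ ν, μ ≠ ν → hermOf η (bB μ) (bB ν) = 0)
    (hpos : ∀ ν, 0 < frameDiag η bB ν) {q : ℕ} (hq : 1 ≤ q) :
    Subsingleton (dbarCohomology Φ η χ bB q) := by
  have hle := hη.dbarClosedForms_le_dbarExactForms hχ bB hb hpos hq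
  refine ⟨fun x y ↦ ?_⟩
  induction x using Submodule.Quotient.induction_on with
  | H σ =>
    induction y using Submodule.Quotient.induction_on with
    | H τ =>
      change dbarCohomology.mk Φ η χ bB q σ = dbarCohomology.mk Φ η χ bB q τ
      rw [dbarCohomology.mk_eq_mk_iff]
      exact sub_mem (hle σ.2) (hle τ.2)

/-- **`h^q(L) = dim_ℂ H^{0,q}_{∂̄}(X, L(H, χ)) = 0` for `q ≥ 1`, `H` positive definite.**
[cite: Lange2023AbelianVarietiesComplex, §1.6.2 Thm. 1.6.4] -/
theorem IsRiemannForm.finrank_dbarCohomology_eq_zero (hη : IsRiemannForm Φ η) (hχ : IsSemicharacter Φ η χ)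
    (bB : Module.Basis (Fin g) ℂ E) (hb : ∀ μ ν, μ ≠ ν → hermOf η (bB μ) (bB ν) = 0)
    (hpos : ∀ ν, 0 < frameDiag η bB ν) {q : ℕ} (hq : 1 ≤ q) :
    Module.finrank ℂ (dbarCohomology Φ η χ bB q) = 0 := by
  haveI := hη.subsingleton_dbarCohomology hχ bB hb hpos hq
  exact Module.finrank_zero_of_subsingleton

/-- **`rank_ℂ H^{0,q}_{∂̄}(X, L(H, χ)) = 0` for `q ≥ 1`, `H` positive definite** (cardinal rank).
[cite: Lange2023AbelianVarietiesComplex, §1.6.2 Thm. 1.6.4] -/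
theorem IsRiemannForm.rank_dbarCohomology_eq_zero (hη : IsRiemannForm Φ η) (hχ : IsSemicharacter Φ η χ)
    (bB : Module.Basis (Fin g) ℂ E) (hb : ∀ μ ν, μ ≠ ν → hermOf η (bB μ) (bB ν) = 0)
    (hpos : ∀ ν, 0 < frameDiag η bB ν) {q : ℕ} (hq : 1 ≤ q) :
    Module.rank ℂ (dbarCohomology Φ η χ bB q) = 0 := by
  haveI := hη.subsingleton_dbarCohomology hχ bB hb hpos hq
  exact rank_subsingleton' ℂ _

/-- **Theorem 1.6.1 for a positive line bundle, every degree: `ℋ^q(L) → H^{0,q}_{∂̄}(X, L)`, `σ ↦ [σ]`, is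
bijective** (`L = L(H, χ)`, `H` positive definite, `H`-orthogonal basis frame, positive Kähler weights).  Degree
`0` is row A2-79 (`Z^{0,0} = ℋ^0`, `B^{0,0} = 0`); for `q ≥ 1` the map is injective (A2-79, positivity of `( , )`)
onto the trivial group `H^{0,q}_{∂̄} = 0` (§14), hence bijective — and so `ℋ^q(L) = 0` as well (Cor. 1.6.7 for
`s = 0`, recovered). [cite: Lange2023AbelianVarietiesComplex, §1.6.1 Thm. 1.6.1] [cite: HuybrechtsCG2005, §4.1 Cor. 4.1.14] -/
theorem IsRiemannForm.harmonicToDolbeault_bijective (hη : IsRiemannForm Φ η) (hχ : IsSemicharacter Φ η χ)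
    (bB : Module.Basis (Fin g) ℂ E) (hb : ∀ μ ν, μ ≠ ν → hermOf η (bB μ) (bB ν) = 0)
    (hpos : ∀ ν, 0 < frameDiag η bB ν) {k : Fin g → ℝ} (hk : ∀ ν, 0 < k ν) (q : ℕ) :
    Function.Bijective (hη.isNSForm.harmonicToDolbeault (b := ⇑bB) hχ hb hk (q := q)) := by
  rcases Nat.eq_zero_or_pos q with rfl | hq
  · exact hη.isNSForm.harmonicToDolbeault_zero_bijective hχ hb hk
  · haveI := hη.subsingleton_dbarCohomology hχ bB hb hpos hq
    exact ⟨hη.isNSForm.harmonicToDolbeault_injective hχ hb hk, fun c ↦ ⟨0, Subsingleton.elim _ _⟩⟩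

/-- **`ℋ^q(L(H, χ)) = 0` for `q ≥ 1` and `H` positive definite** (Lange Cor. 1.6.7 with `s = 0`), read off the
injection into the trivial `H^{0,q}_{∂̄}`. [cite: Lange2023AbelianVarietiesComplex, §1.6.2 Cor. 1.6.7] -/
theorem IsRiemannForm.harmonicForms_eq_bot (hη : IsRiemannForm Φ η) (hχ : IsSemicharacter Φ η χ)
    (bB : Module.Basis (Fin g) ℂ E) (hb : ∀ μ ν, μ ≠ ν → hermOf η (bB μ) (bB ν) = 0)
    (hpos : ∀ ν, 0 < frameDiag η bB ν) {k : Fin g → ℝ} (hk : ∀ ν, 0 < k ν) {q : ℕ} (hq : 1 ≤ q) :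
    hη.isNSForm.harmonicForms (⇑bB) k χ q = ⊥ := by
  haveI := hη.subsingleton_dbarCohomology hχ bB hb hpos hq
  refine (Submodule.eq_bot_iff _).2 fun σ hσ ↦ ?_
  have h := hη.isNSForm.harmonicToDolbeault_injective (b := ⇑bB) hχ hb hk (q := q)
    (a₁ := ⟨σ, hσ⟩) (a₂ := 0) (Subsingleton.elim _ _)
  exact congr_arg Subtype.val h

/-- **The table `h^q(L) = [q = 0] · h⁰(L)`** for a positive line bundle `L = L(H, χ)` on a complex torus:
`dim_ℂ H^{0,q}_{∂̄}(X, L) = h⁰(L)` for `q = 0` (row A2-79) and `= 0` for `q ≥ 1` (§14); here `h⁰(L) = Pf(E)`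
(row A2-20's `lineBundleAH`). [cite: Lange2023AbelianVarietiesComplex, §1.6.2 Thm. 1.6.4] [cite: Lange2023AbelianVarietiesComplex, §1.6.1 Thm. 1.6.1] -/
theorem IsRiemannForm.finrank_dbarCohomology (hη : IsRiemannForm Φ η) (hχ : IsSemicharacter Φ η χ)
    (bB : Module.Basis (Fin g) ℂ E) (hb : ∀ μ ν, μ ≠ ν → hermOf η (bB μ) (bB ν) = 0)
    (hpos : ∀ ν, 0 < frameDiag η bB ν) (q : ℕ) :
    Module.finrank ℂ (dbarCohomology Φ η χ bB q) = if q = 0 then (lineBundleAH hη.isNSForm hχ).h0 else 0 := by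
  split_ifs with h
  · subst h
    exact hη.isNSForm.finrank_dbarCohomology_zero (b := ⇑bB) (k := fun _ ↦ (1 : ℝ)) hχ hb (fun _ ↦ one_pos)
      bB.span_eq
  · exact hη.finrank_dbarCohomology_eq_zero hχ bB hb hpos (Nat.one_le_iff_ne_zero.2 h)

end HodgeIsomorphism

end ComplexTorus

end Literature.Geometry.Kaehler
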